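/-
Copyright (c) 2026. Released under the Apache 2.0 license.
-/
import Literature.NumberTheory.EllipticCurves.SemistabilityDefectAtThreeTameWitnessProofs
import Literature.NumberTheory.EllipticCurves.HasseWeilAbelianPotentialGoodReductionProofs
import Literature.NumberTheory.EllipticCurves.SemistableReductionBaseChange
import Literature.NumberTheory.DiophantineGeometry.LocalReductionHasMultiplicativeReductionAtProofs
import Literature.NumberTheory.DiophantineGeometry.LocalReductionFiniteBadPlacesProofs
import Literature.NumberTheory.DiophantineGeometry.MinimalDiscriminantBaseChangeCongruence
import Literature.NumberTheory.DiophantineGeometry.TameAdditiveTypesAtTwoProofs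
import Mathlib.FieldTheory.IsAlgClosed.AlgebraicClosure
import HarnessLib

/-!
# Serre's formula for the semistability defect at `p ≥ 5` — PROVED:
# `W.semistabilityDefectAt p = 12 / gcd(12, ord_p Δ_min)` for every elliptic `W/ℚ` with `ord_p j ≥ 0`
# (Serre 1972 §5.6: "`Φ_p = C_d`, `d = 12 / gcd(12, v_p(Δ))`"; Kraus 1990 "défaut de semi-stabilité")

`Proofs` file (theorems only: no definition, no named fact, no instance), topic
`Literature/NumberTheory/EllipticCurves`; third sequel of `SemistabilityDefect.lean` (which DEFINES
`WeierstrassCurve.IsSemistabilityWitnessAt W p e` — a number field `F` and a finite place `w ∋ p` of `F`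
with `e(w ∣ p) = e` at which `W_F` is semistable — and `WeierstrassCurve.semistabilityDefectAt W p`, the
least such `e`), after `SemistabilityDefectDiscriminantBoundProofs.lean` (the LOWER half, at every `p`:
`12 / gcd(12, ord_p Δ_min)` divides the index of every witness, hence the defect) and
`SemistabilityDefectAtThreeTameWitnessProofs.lean` (the UPPER half on the three rows `I₀*`, III, III*
at an odd `p`, by explicit Tate normal forms). Here the UPPER half is proved UNIFORMLY at every prime
`p ≥ 5` and for every potentially good `W` (no Kodaira-type case analysis), which is Serre's theorem as
the module docstring of `SemistabilityDefect.lean` asks for it: "for potentially good reduction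
`12/gcd(12, v_p Δ)` at `p ≥ 5` (Serre) … to be vendored as named facts only when a consumer needs
them" — it is now a THEOREM, so no named fact is needed. Consumers: the sign-law / type dichotomies
"`e ∤ p − 1` (supercuspidal) / `e ∣ p − 1` (principal series)" at an additive potentially good `p ≥ 5`
that are phrased over `semistabilityDefectAt` (e.g. `Summits/BirchSwinnertonDyer/…/Cruxes/
LevelKolyvaginSystemsAdditive/RamifiedHabitatKuriharaSlotSketch.lean` §1, §3) can now be read off
`ord_p Δ_min ∈ {2, 3, 4, 6, 8, 9, 10}` (`e = 6, 4, 3, 2, 3, 4, 6`).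

## The printed statement followed

[Serre1972] J.-P. Serre, *Propriétés galoisiennes des points d'ordre fini des courbes elliptiques*,
Invent. Math. 15 (1972), §5.6 p. 312 (as quoted VERBATIM by [MartinWatkins2006] §3.2 and rendered in the
tree's `Serre1972/PotentiallyGoodInertiaOrder.lean`): for `p ≥ 5` and potentially good reduction "the
inertia group is `Φ = C_d` where `d = 12/gcd(12, v_p(Δ_E))`". Read through the definition of
`SemistabilityDefect.lean` (Coppola 2020 §2: `|Φ_p| = [L : ℚ_p^{nr}]`, `L` the minimal extension of
`ℚ_p^{nr}` over which `E` acquires good reduction, `=` the least ramification index of a field of good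
reduction), the theorem says: (lower) every field of good reduction has ramification index divisible by
`d` — PROVED in `SemistabilityDefectDiscriminantBoundProofs.lean`; (upper) SOME number field has a place
`w ∣ p` of ramification index EXACTLY `d` at which `E` has good reduction — PROVED here, with
`F = ℚ(p^{1/d})`: [FreitasKraus2022] Thm. 15 (1) "we can take `F = ℚ_ℓ(ℓ^{1/e})`", and Silverman
*AEC* VII.5 Prop. 5.1 (a) / Remark VII.1.1: at residue characteristic `≥ 5`, `v(j) ≥ 0` and
`12 ∣ v(Δ)` give an integral short Weierstrass model with unit discriminant.

## What is PROVED (all unconditional, standard axioms)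

§1 `hasGoodReductionAt_of_valuation_j_le_one_of_exists_pow_twelve` — over any number field `L`, at a
place `w ∤ 6`: `|j|_w ≤ 1` and `|Δ|_w` a twelfth power in the value group ⟹ GOOD reduction at `w`
(rescale by `δ`, pass to the short Weierstrass form: `c₄³ = j·Δ₁`, `c₆² = c₄³ − 1728 Δ₁` are integral;
the Literature-side form of the Summits lemma
`Summit.BirchSwinnertonDyer.Rank1Residual.Additive.hasGoodReductionAt_of_valuation_j_le_one_of_valuation_pow_twelve`,
restated with an existential so that both can coexist).
§2 `hasGoodReductionAt_baseChange_of_twelve_dvd_ramificationIdx_mul` — `W/ℚ` elliptic, `p ≥ 5`,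
`ord_p j ≥ 0`, `F` ANY number field, `w ∋ p` ANY place with `12 ∣ e(w ∣ p) · ord_p Δ_min` ⟹ `W_F` is
GOOD at `w` (`|Δ_W|_w = |Δ_W|_v^{e(w∣p)}` by Mathlib's `valuation_liesOver`,
`ord_p Δ_W ≡ ord_p Δ_min (mod 12)`, a uniformiser power as `δ`); and the LOCAL CRITERION
**`hasGoodReductionAt_baseChange_iff_twelve_div_gcd_dvd_ramificationIdx`**:
`W_F` good at `w` **iff** `12 / gcd(12, ord_p Δ_min) ∣ e(w ∣ p)` (⇒ is the tree's
`twelve_dvd_ramificationIdx_mul_ordMinimalDiscriminant_of_hasGoodReductionAt_baseChange`);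
`isSemistableAt_baseChange_iff_…` (above a potentially good `p` semistable = good).
§3 `hasGoodReductionAt_baseChange_of_pow_eq_natCast` — if `θ ∈ F`, `θⁿ = p` and
`12 ∣ n · ord_p Δ_min` then `W_F` is good at every `w ∋ p` (`θⁿ = p` forces `n ∣ e(w ∣ p)`);
`exists_numberField_pow_eq_algebraMap` — a number field of degree `≤ n` with an `n`-th root of any
`q ∈ ℚ` (`ℚ[X]/(minpoly)`; private plumbing, as in the tame-witness file).
§4 **`isSemistabilityWitnessAt_twelve_div_gcd_of_five_le`** (a witness of index EXACTLY
`d = 12 / gcd(12, ord_p Δ_min)`: `d ∣ e(w ∣ p) ≤ [F : ℚ] ≤ d`),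
**`semistabilityDefectAt_eq_twelve_div_gcd_of_five_le`** (SERRE'S FORMULA),
`semistabilityDefectAt_pos_of_five_le`, `semistabilityDefectAt_dvd_twelve_of_five_le`,
`isSemistabilityWitnessAt_iff_of_five_le` (`e` is a witness index iff `d ∣ e` and some number field
has a place of ramification index `e` above `p` at which … — stated as: every witness index is a
multiple of the defect, `semistabilityDefectAt_dvd_of_isSemistabilityWitnessAt_of_five_le`).
§5 (the `p`-adic currency of `RootNumber.lean` / `BSDRootNumber.lean`, where Rohrlich's case list is
evaluated on the chosen `ℤ_p`-minimal model `X = (W.baseChange ℚ_[p]).minimal ℤ_[p]` with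
`e := 12 / gcd(ord Δ(X), 12)` and the potentially-good test `¬ 3·ord c₄(X) < ord Δ(X)`):
`ordMinimalDiscriminant_eq_toNat_addVal_minimal_padic` (`ord_p Δ_min = ord Δ(X)`, the tree's
`ordMinimalDiscriminant_eq_padic` at a named prime), `padicValRat_j_nonneg_iff_not_addVal_lt`
(`ord_p j ≥ 0 ↔ ¬ 3·ord c₄(X) < ord Δ(X)`), **`semistabilityDefectAt_eq_twelve_div_gcd_addVal_of_five_le`**
(ROHRLICH'S `e` IS KRAUS'S DEFECT: `W.semistabilityDefectAt p = 12 / gcd(ord Δ(X), 12)`), its form with a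
named exponent `ord Δ(X) = a`, and the global-minimal-equation form
`semistabilityDefectAt_eq_twelve_div_gcd_padicValInt_of_five_le` (`= 12 / gcd(12, ord_p Δ_min(E))` with
`minimalDiscriminantInt`, the census currency `semistabilityIndex` of `Summits/…/Rank1Residual`).
§6 `isSemistableAt_of_one_le_valuation_j_of_exists_pow_four` — the unit-`c₄` companion of §1 over the
fraction field of ANY Dedekind domain at a place `v ∤ 6`: `|j|_v ≥ 1` and `|c₄|_v = |δ|_v⁴` ⟹ semistable
(multiplicative unless `|j|_v = 1`).
§7 the potentially MULTIPLICATIVE rows (`ord_p j < 0`, `p ≥ 5`): `2 ∣ ord_p c₄` for every equation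
(`c₄_ne_zero_and_even_padicValRat_c₄_of_padicValRat_j_neg`); `4 ∣ ord_p c₄ ⟹ W` semistable at `p`
(`isSemistableAt_of_padicValRat_j_neg_of_four_dvd`, so at an ADDITIVE such prime `ord_p c₄ ≡ 2 (mod 4)`);
`4 ∣ e(w∣p)·ord_p c₄ ⟹ W_F` semistable at `w`; multiplicative reduction upstairs forces `4 ∣ e(w∣p)·ord_p c₄`;
the witness `ℚ(√p)` of index `2` (`isSemistabilityWitnessAt_two_of_padicValRat_j_neg`); every witness at an
additive potentially multiplicative `p` has even index; **`semistabilityDefectAt_eq_two_of_padicValRat_j_neg_of_not_isSemistableAt`**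
(KRAUS: the defect is EXACTLY `2` there).
§8 the semistable row: `isSemistabilityWitnessAt_one_of_isSemistableAt` (`F = ℚ`),
**`semistabilityDefectAt_eq_one_of_isSemistableAt`** (any `p`); the complete statement at `p ≥ 5`
`semistabilityDefectAt_of_five_le` (`1` / `2` / `12/gcd(12, ord_p Δ_min)` on the semistable / potentially
multiplicative / potentially good rows) and `semistabilityDefectAt_pos_of_five_le'` (a witness ALWAYS exists
at `p ≥ 5`: the semistable reduction theorem on this class, with explicit fields).
§9 prime-indexed forms in the `ℤ_p`-currency of `Tamagawa.lean` (`HasGoodReductionAtPrime`,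
`HasMultiplicativeReductionAtPrime`; the census class `Addv W p` is `¬ good ∧ ¬ mult`):
`isSemistableAt_iff_hasGoodReductionAtPrime_or`, `semistabilityDefectAt_eq_one_of_good_or_mult`,
`semistabilityDefectAt_eq_two_of_not_good_of_not_mult`; and the CONVERSE of §8 at `p ≥ 5`:
**`semistabilityDefectAt_eq_one_iff_isSemistableAt`**, `one_lt_semistabilityDefectAt_of_not_isSemistableAt`.
§10 Serre's TABLE at an additive potentially good `p ≥ 5`:
`ordMinimalDiscriminant_mem_of_hasAdditiveReductionAt_of_padicValRat_j_nonneg` (`ord_p Δ_min ∈ {2,3,4,6,8,9,10}`,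
Kodaira II…II* with `Iₙ*`, `n ≥ 1` excluded by `ord_p j ≥ 0`),
`semistabilityDefectAt_mem_of_hasAdditiveReductionAt_of_padicValRat_j_nonneg` (defect `∈ {2,3,4,6}`),
`not_isSemistableAt_iff_hasAdditiveReductionAt`, the `ℤ_p`-currency forms
`toNat_addVal_Δ_minimal_padic_mem_of_hasAdditiveReduction`, `addVal_ne_zero_of_hasAdditiveReduction_minimal_padic`,
`hasAdditiveReduction_minimal_padic_of_not_good_of_not_mult`, and
`padicValRat_j_nonneg_of_not_semistabilityDefectAt_dvd` (`¬ defect ∣ p − 1` excludes the potentially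
multiplicative rows).
§11 ROHRLICH'S LOCAL ROOT NUMBER READ THROUGH THE DEFECT (`p ≥ 5`, additive):
**`localRootNumber_padic_eq_of_hasAdditiveReduction_of_five_le`** (`W_p = (−3/p)` if `e = 3`, `χ₈'(p)` if
`e = 4`, `χ₄(p)` otherwise — `e ∈ {2, 6}` and every potentially multiplicative row), the three clean rows
`…_eq_χ₄_of_semistabilityDefectAt_eq_two_or_six`, `…_of_semistabilityDefectAt_eq_three`,
`…_eq_χ₈'_of_semistabilityDefectAt_eq_four`, and the `Addv`-shaped `localRootNumber_padic_eq_of_not_good_of_not_mult`.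

## What is NOT here

`p = 2, 3` (Kraus 1990: the defect is NOT a function of `ord_p Δ_min` there — wild inertia; the tame
rows at `3` are `SemistabilityDefectAtThreeTameWitnessProofs.lean`); the cyclicity of `Φ_p`; the row-by-row
Kodaira dictionary `II, III, IV, I₀*, IV*, III*, II* ↦ 6, 4, 3, 2, 3, 4, 6` WITHOUT the hypothesis
`ord_p j ≥ 0` (it needs `ord_p j ≥ 0` from the symbol, which the tree proves Summits-side:
`Summits/BirchSwinnertonDyer/Rank1Residual/X11b/Three/CornerShapeII.lean`, `…CornerShapeGamma.lean`, and
`Summits/…/Theorems/AdditiveKolyvaginRoadSemistabilityDefectDictionary.lean` §2); any statement about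
singular `W` (the defect is junk there).

## References

* [Serre1972] J.-P. Serre, Invent. Math. 15 (1972) 259–331, §5.6 (p. 312).
* [MartinWatkins2006] P. Martin, M. Watkins, *Symmetric powers of elliptic curve L-functions*,
  ANTS VII, LNCS 4076 (2006), §3.2 (verbatim quotation of Serre's formula; held).
* [Kraus1990] A. Kraus, Manuscripta Math. 69 (1990) 353–385 (title notion; `p ≥ 5` recalled in §1).
* [FreitasKraus2022] N. Freitas, A. Kraus, Mem. AMS 277 (2022) no. 1363, §3.3 and Thm. 15 (1)
  (held text `paper:arxiv-1607.01218`).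
* [Coppola2020] N. Coppola, Acta Arith. 195 (2020) §2 (definition of `L`, `|Φ| = [L : K^{nr}]`).
* [SilvermanAEC2009] J. H. Silverman, GTM 106 (2nd ed.), VII.1 Remark 1.1, Prop. 1.3; VII.5 Prop. 5.1 (a),
  Prop. 5.4, Prop. 5.5; VIII.1 Remark 1.3.
-/

noncomputable section

open scoped Classical NumberField

open IsDedekindDomain IsDedekindDomain.HeightOneSpectrum WithZero NumberField

namespace WeierstrassCurve

/-! ## §1. Good reduction from `|j|_w ≤ 1` and `|Δ|_w ∈ (value group)¹²` at a place `w ∤ 6` -/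

section Criterion

variable {L : Type*} [Field L] [NumberField L] (V : WeierstrassCurve L) [V.IsElliptic]
  {w : HeightOneSpectrum (𝓞 L)}

/-- **Good reduction at a place `w ∤ 6` with integral `j` and `12 ∣ ord_w(Δ)`** (Silverman *AEC*
VII.5 Prop. 5.1 (a) with Remark VII.1.1: at residue characteristic `≥ 5`, a curve with `ord_w(j) ≥ 0`
whose discriminant valuation is a multiple of `12` has a `w`-integral equation with unit discriminant;
this is the local content of Serre–Tate's "potentially good reduction becomes good over every extension
whose ramification index kills `Φ_p`"). Hypotheses in the value group: `|j|_w ≤ 1` and `|δ|_w¹² = |Δ|_w`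
for some `δ ∈ L`. Proof: rescale by `δ` (`Δ₁ = δ⁻¹² Δ` is a `w`-unit), so `c₄³ = j Δ₁` and
`c₆² = c₄³ − 1728 Δ₁` are `w`-integral, and the short Weierstrass form (`2, 3 ∈ O_wˣ`) is `w`-integral
with unit discriminant (`hasGoodReductionAt_of_valuation_le_one_of_valuation_Δ_eq_one`); good reduction
is invariant under the two changes of variables (`hasGoodReductionAt_smul_iff_holds`). Literature-side
form (with an existential hypothesis) of the Summits lemma
`Summit.BirchSwinnertonDyer.Rank1Residual.Additive.hasGoodReductionAt_of_valuation_j_le_one_of_valuation_pow_twelve`.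
[cite: SilvermanAEC2009, VII.5 Prop. 5.1 (a) and VII.1 Remark 1.1] -/
theorem hasGoodReductionAt_of_valuation_j_le_one_of_exists_pow_twelve
    (h2 : (2 : 𝓞 L) ∉ w.asIdeal) (h3 : (3 : 𝓞 L) ∉ w.asIdeal) (hj : w.valuation L V.j ≤ 1)
    (hδ : ∃ δ : L, w.valuation L δ ^ 12 = w.valuation L V.Δ) : V.HasGoodReductionAt w := by
  obtain ⟨δ, hδ⟩ := hδ
  -- `2`, `3` are `w`-units
  have h2u : w.valuation L (2 : L) = 1 := by
    simpa using valuation_natCast_eq_one_of_natCast_notMem (K := L) (q := 2) (by simpa using h2)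
  have h3u : w.valuation L (3 : L) = 1 := by
    simpa using valuation_natCast_eq_one_of_natCast_notMem (K := L) (q := 3) (by simpa using h3)
  have h48 : w.valuation L (48 : L) = 1 := by
    rw [show (48 : L) = 2 ^ 4 * 3 by norm_num, map_mul, map_pow, h2u, h3u]; simp
  have h864 : w.valuation L (864 : L) = 1 := by
    rw [show (864 : L) = 2 ^ 5 * 3 ^ 3 by norm_num, map_mul, map_pow, map_pow, h2u, h3u]; simp
  have h1728 : w.valuation L (1728 : L) = 1 := by
    rw [show (1728 : L) = 2 ^ 6 * 3 ^ 3 by norm_num, map_mul, map_pow, map_pow, h2u, h3u]; simp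
  -- `δ ≠ 0`
  have hΔ0 : V.Δ ≠ 0 := V.isUnit_Δ.ne_zero
  have hδ0 : δ ≠ 0 := by
    rintro rfl
    rw [map_zero, zero_pow (by norm_num)] at hδ
    exact (Valuation.ne_zero_iff _).mpr hΔ0 hδ.symm
  -- the rescaled equation `W₁ = (δ, 0, 0, 0) • V` has `|Δ₁|_w = 1`
  set C₁ : VariableChange L := ⟨Units.mk0 δ hδ0, 0, 0, 0⟩ with hC₁
  set W₁ := C₁ • V with hW₁
  haveI hW₁ell : W₁.IsElliptic := inferInstanceAs (C₁ • V).IsElliptic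
  have hC₁u : (↑C₁.u⁻¹ : L) = δ⁻¹ := by rw [Units.val_inv_eq_inv_val, hC₁, Units.val_mk0]
  have hΔ₁ : W₁.Δ = δ⁻¹ ^ 12 * V.Δ := by rw [hW₁, variableChange_Δ, hC₁u]
  have hvΔ₁ : w.valuation L W₁.Δ = 1 := by
    have hvδ : w.valuation L δ ≠ 0 := (Valuation.ne_zero_iff _).mpr hδ0
    rw [hΔ₁, map_mul, map_pow, map_inv₀, ← hδ, inv_pow, inv_mul_cancel₀ (pow_ne_zero _ hvδ)]
  have hj₁ : W₁.j = V.j := V.variableChange_j C₁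
  -- `c₄³ = j Δ₁` and `c₆² = c₄³ − 1728 Δ₁` are `w`-integral
  have hc4cube : W₁.c₄ ^ 3 = W₁.j * W₁.Δ := by
    rw [WeierstrassCurve.j, ← coe_Δ', mul_comm (↑W₁.Δ'⁻¹ : L), mul_assoc, Units.inv_mul, mul_one]
  have hc4 : w.valuation L W₁.c₄ ≤ 1 := by
    rw [← pow_le_one_iff three_ne_zero, ← map_pow, hc4cube, map_mul, hvΔ₁, mul_one, hj₁]
    exact hj
  have hc6 : w.valuation L W₁.c₆ ≤ 1 := by
    have hrel : W₁.c₆ ^ 2 = W₁.c₄ ^ 3 - 1728 * W₁.Δ := by rw [c_relation]; ring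
    rw [← pow_le_one_iff two_ne_zero, ← map_pow, hrel]
    refine le_trans (Valuation.map_sub _ _ _) (max_le ?_ ?_)
    · rw [hc4cube, map_mul, hvΔ₁, mul_one, hj₁]; exact hj
    · rw [map_mul, h1728, hvΔ₁, mul_one]
  -- the short Weierstrass form `S = toShortNF • W₁`
  letI : Invertible (2 : L) := invertibleOfNonzero two_ne_zero
  letI : Invertible (3 : L) := invertibleOfNonzero three_ne_zero
  set S := W₁.toShortNF • W₁ with hS
  haveI : S.IsShortNF := W₁.toShortNF_spec
  have hSu : W₁.toShortNF.u = 1 := by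
    simp [toShortNF, toCharNeTwoNF, VariableChange.mul_def]
  have hSu' : (↑W₁.toShortNF.u⁻¹ : L) = 1 := by rw [hSu, inv_one, Units.val_one]
  have hSc4 : S.c₄ = W₁.c₄ := by rw [hS, variableChange_c₄, hSu', one_pow, one_mul]
  have hSc6 : S.c₆ = W₁.c₆ := by rw [hS, variableChange_c₆, hSu', one_pow, one_mul]
  have hSΔ : S.Δ = W₁.Δ := by rw [hS, variableChange_Δ, hSu', one_pow, one_mul]
  have ha4 : w.valuation L S.a₄ ≤ 1 := by
    have h : w.valuation L S.a₄ = w.valuation L S.c₄ := by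
      rw [S.c₄_of_isShortNF, map_mul, Valuation.map_neg, h48, one_mul]
    rw [h, hSc4]; exact hc4
  have ha6 : w.valuation L S.a₆ ≤ 1 := by
    have h : w.valuation L S.a₆ = w.valuation L S.c₆ := by
      rw [S.c₆_of_isShortNF, map_mul, Valuation.map_neg, h864, one_mul]
    rw [h, hSc6]; exact hc6
  have hgoodS : S.HasGoodReductionAt w :=
    S.hasGoodReductionAt_of_valuation_le_one_of_valuation_Δ_eq_one w
      (by rw [S.a₁_of_isShortNF, map_zero]; exact zero_le)
      (by rw [S.a₂_of_isShortNF, map_zero]; exact zero_le)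
      (by rw [S.a₃_of_isShortNF, map_zero]; exact zero_le) ha4 ha6
      (by rw [hSΔ, hvΔ₁])
  -- transport back along the two changes of variables
  have hgood₁ : W₁.HasGoodReductionAt w := (hasGoodReductionAt_smul_iff_holds w W₁ _).mp hgoodS
  exact (hasGoodReductionAt_smul_iff_holds w V C₁).mp hgood₁

end Criterion

/-! ## §2. Over `ℚ`: `W_F` is good at `w ∣ p` as soon as `12 ∣ e(w ∣ p) · ord_p(Δ_min)` (`p ≥ 5`,
`ord_p j ≥ 0`), and the local criterion -/

section Rational

open Rat.HeightOneSpectrum Literature.NumberTheory.EllipticCurves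

variable (W : WeierstrassCurve ℚ) [W.IsElliptic] {p : ℕ} (v : HeightOneSpectrum ℤ)

/-- Place bookkeeping: a place `w ∋ p` of a number field `F` lies over the place `v` of `ℤ` with
`primesEquiv v = p` (same private plumbing as in the two sibling `SemistabilityDefect…Proofs` files).
[folklore] -/
private theorem liesOver_of_natCast_mem_serre (hv : ((primesEquiv (R := ℤ) v : Nat.Primes) : ℕ) = p)
    {F : Type*} [Field F] (w : HeightOneSpectrum (𝓞 F)) (hw : (p : 𝓞 F) ∈ w.asIdeal) :
    w.asIdeal.LiesOver v.asIdeal := by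
  have hgen : natGenerator v = p := hv
  have hvspan : v.asIdeal = Ideal.span {(p : ℤ)} := by
    rw [asIdeal_eq_span_natGenerator_int, hgen]
  have hle : v.asIdeal ≤ w.asIdeal.under ℤ := by
    rw [hvspan, Ideal.span_le, Set.singleton_subset_iff, SetLike.mem_coe, Ideal.under_def,
      Ideal.mem_comap, map_natCast]
    exact hw
  exact ⟨((v.isMaximal.eq_of_le (Ideal.IsPrime.ne_top inferInstance) hle).symm).symm⟩

/-- At a place `w` of a number field over the rational prime `p ≥ 5`, the integers `2` and `3` are
`w`-units (`w ∩ ℤ = (p)` and `p ∤ 2, 3`). [folklore] -/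
private theorem two_three_notMem_of_five_le (hv : ((primesEquiv (R := ℤ) v : Nat.Primes) : ℕ) = p)
    (hp5 : 5 ≤ p) {F : Type*} [Field F] [NumberField F] (w : HeightOneSpectrum (𝓞 F))
    (hw : (p : 𝓞 F) ∈ w.asIdeal) : (2 : 𝓞 F) ∉ w.asIdeal ∧ (3 : 𝓞 F) ∉ w.asIdeal := by
  haveI : w.asIdeal.LiesOver v.asIdeal := liesOver_of_natCast_mem_serre v hv w hw
  have hgen : natGenerator v = p := hv
  have hvspan : v.asIdeal = Ideal.span {(p : ℤ)} := by
    rw [asIdeal_eq_span_natGenerator_int, hgen]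
  have hunder : w.asIdeal.under ℤ = v.asIdeal :=
    (Ideal.LiesOver.over (P := w.asIdeal) (p := v.asIdeal)).symm
  have hnotMem : ∀ q : ℕ, q < p → q ≠ 0 → (q : 𝓞 F) ∉ w.asIdeal := by
    intro q hq hq0 hmem
    have h1 : (q : ℤ) ∈ w.asIdeal.under ℤ := by
      rw [Ideal.under_def, Ideal.mem_comap, map_natCast]; exact hmem
    rw [hunder, hvspan, Ideal.mem_span_singleton] at h1
    have h2 : p ∣ q := by exact_mod_cast h1
    exact absurd (Nat.le_of_dvd (Nat.pos_of_ne_zero hq0) h2) (not_le.mpr hq)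
  exact ⟨by simpa using hnotMem 2 (by omega) two_ne_zero,
    by simpa using hnotMem 3 (by omega) three_ne_zero⟩

/-- **`W_F` is GOOD at `w ∣ p` whenever `12 ∣ e(w ∣ p) · ord_p(Δ_min)`** (`W/ℚ` elliptic, `p ≥ 5`,
`ord_p j ≥ 0`; `F` ANY number field, `w ∋ p` ANY finite place; `v` the place of `ℤ` over `p`,
`e(w ∣ p) = ramificationIdx'`). This is the (⇐) half of Serre–Tate's criterion "a potentially good `E/ℚ_p`
has good reduction over `K′` iff `[K′ℚ_p^{nr} : ℚ_p^{nr}]` is a multiple of `|Φ_p| = 12/gcd(12, v_p Δ)`"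
(Serre 1972 §5.6, `p ≥ 5`), here by pure valuation theory: `|Δ_W|_w = |Δ_W|_v^{e(w∣p)}` (Mathlib
`valuation_liesOver`), `ord_p Δ_W ≡ ord_p Δ_min (mod 12)` for the given equation
(`twelve_dvd_ordMinimalDiscriminant_sub_padicValRat_Δ`), so `|Δ_W|_w = |π_w|^{12k}` for a uniformiser
`π_w` and an INTEGER `k`, and §1 applies with `δ = π_w^k`.
[cite: Serre1972, §5.6 (p. 312), as quoted by MartinWatkins2006 §3.2] [cite: SilvermanAEC2009, VII.5 Prop. 5.1 (a) and VII.1 Remark 1.1] -/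
theorem hasGoodReductionAt_baseChange_of_twelve_dvd_ramificationIdx_mul
    (hv : ((primesEquiv (R := ℤ) v : Nat.Primes) : ℕ) = p) (hp5 : 5 ≤ p) (hj : 0 ≤ padicValRat p W.j)
    {F : Type*} [Field F] [NumberField F] (w : HeightOneSpectrum (𝓞 F)) (hw : (p : 𝓞 F) ∈ w.asIdeal)
    (h12 : 12 ∣ v.asIdeal.ramificationIdx' w.asIdeal * W.ordMinimalDiscriminant v) :
    (W.baseChange F).HasGoodReductionAt w := by
  haveI : w.asIdeal.LiesOver v.asIdeal := liesOver_of_natCast_mem_serre v hv w hw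
  have hgen : natGenerator v = p := hv
  have hp : p.Prime := hgen ▸ prime_natGenerator v
  obtain ⟨h2, h3⟩ := two_three_notMem_of_five_le v hv hp5 w hw
  set e : ℕ := v.asIdeal.ramificationIdx' w.asIdeal with he
  -- the curve upstairs
  haveI : (W.baseChange F).IsElliptic := by rw [baseChange]; infer_instance
  have hjF : (W.baseChange F).j = algebraMap ℚ F W.j := W.map_j (algebraMap ℚ F)
  have hΔF : (W.baseChange F).Δ = algebraMap ℚ F W.Δ := by rw [baseChange, map_Δ]
  -- `|j|_w ≤ 1`
  have hjw : w.valuation F (W.baseChange F).j ≤ 1 := by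
    rw [hjF, ← valuation_liesOver (K := ℚ) (L := F) v w W.j]
    apply pow_le_one₀ zero_le
    by_cases hj0 : W.j = 0
    · rw [hj0, map_zero]; exact zero_le
    rw [valuation_eq_exp_neg_padicValRat v hj0, hgen, ← exp_zero, exp_le_exp]
    omega
  -- `12 ∣ e · ord_p(Δ_W)` for the given equation, from `ord_p Δ_W ≡ ord_p Δ_min (mod 12)`
  have hΔ0 : W.Δ ≠ 0 := W.isUnit_Δ.ne_zero
  have hcong := W.twelve_dvd_ordMinimalDiscriminant_sub_padicValRat_Δ v
  rw [hgen] at hcong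
  have h12Z : (12 : ℤ) ∣ (e : ℤ) * padicValRat p W.Δ := by
    have h1 : (12 : ℤ) ∣ (e : ℤ) * (W.ordMinimalDiscriminant v : ℤ) := by exact_mod_cast h12
    have h2 := hcong.mul_left (e : ℤ)
    have : (e : ℤ) * padicValRat p W.Δ =
        (e : ℤ) * (W.ordMinimalDiscriminant v : ℤ) -
          (e : ℤ) * ((W.ordMinimalDiscriminant v : ℤ) - padicValRat p W.Δ) := by ring
    rw [this]
    exact dvd_sub h1 h2
  obtain ⟨k, hk⟩ := h12Z
  -- `|Δ|_w = exp(−12 k)`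
  have hvΔ : w.valuation F (W.baseChange F).Δ = exp (-(12 * k)) := by
    rw [hΔF, ← valuation_liesOver (K := ℚ) (L := F) v w W.Δ, valuation_eq_exp_neg_padicValRat v hΔ0,
      hgen, ← exp_nsmul, ← he, nsmul_eq_mul, ← hk]
    congr 1
    ring
  -- a uniformiser power `δ = π^k` (`k ∈ ℤ`) with `|δ|_w¹² = |Δ|_w`
  obtain ⟨π, hπ⟩ := w.valuation_exists_uniformizer F
  have hδ : w.valuation F (π ^ k) ^ 12 = w.valuation F (W.baseChange F).Δ := by
    rw [hvΔ, map_zpow₀, hπ, ← exp_zsmul, ← exp_nsmul]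
    congr 1
    simp only [smul_eq_mul, nsmul_eq_mul]
    push_cast
    ring
  exact hasGoodReductionAt_of_valuation_j_le_one_of_exists_pow_twelve (W.baseChange F) h2 h3 hjw
    ⟨π ^ k, hδ⟩

/-- The arithmetic of Serre's number: `12 / gcd(12, m) ∣ e ↔ 12 ∣ e · m`. [folklore] -/
private theorem twelve_div_gcd_dvd_iff_twelve_dvd_mul (m e : ℕ) : 12 / Nat.gcd 12 m ∣ e ↔ 12 ∣ e * m := by
  set g := Nat.gcd 12 m with hg
  have hg0 : 0 < g := Nat.gcd_pos_of_pos_left _ (by norm_num)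
  obtain ⟨a, ha⟩ : g ∣ 12 := Nat.gcd_dvd_left 12 m
  obtain ⟨b, hb⟩ : g ∣ m := Nat.gcd_dvd_right 12 m
  have hcop : Nat.Coprime a b := by
    have h := Nat.coprime_div_gcd_div_gcd (m := 12) (n := m) hg0
    rw [← hg] at h
    have ha' : 12 / g = a := by
      rw [ha, Nat.mul_div_cancel_left _ hg0]
    have hb' : m / g = b := by
      rw [hb, Nat.mul_div_cancel_left _ hg0]
    rwa [ha', hb'] at h
  have ha' : 12 / g = a := by rw [ha, Nat.mul_div_cancel_left _ hg0]
  rw [ha']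
  constructor
  · rintro ⟨c, hc⟩
    refine ⟨c * b, ?_⟩
    rw [hc, hb, ha]; ring
  · rintro ⟨c, hc⟩
    -- `e · g · b = g · a · c`, so `a ∣ e · b`, and `a ⊥ b`
    have h1 : e * b = a * c := by
      have : g * (e * b) = g * (a * c) := by
        calc g * (e * b) = e * (g * b) := by ring
          _ = e * m := by rw [hb]
          _ = 12 * c := hc
          _ = g * (a * c) := by rw [ha]; ring
      exact Nat.eq_of_mul_eq_mul_left hg0 this
    exact hcop.dvd_of_dvd_mul_right ⟨c, h1⟩

/-- **THE LOCAL CRITERION at `p ≥ 5` (Serre–Tate / Serre 1972 §5.6, valuation form).** For `W/ℚ`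
elliptic with `ord_p j ≥ 0`, `p ≥ 5`, ANY number field `F` and ANY place `w ∋ p`:
**`W_F` has good reduction at `w` iff `12 / gcd(12, ord_p Δ_min) ∣ e(w ∣ p)`** — (⇒) is the tree's
`twelve_dvd_ramificationIdx_mul_ordMinimalDiscriminant_of_hasGoodReductionAt_baseChange` (a `w`-minimal
model has unit discriminant), (⇐) is the previous theorem. In print: "`E` has good reduction over `K′`
iff `I_{K′} ⊆ ker(Φ_p)`, i.e. iff `|Φ_p| = 12/gcd(12, v_p Δ)` divides `e(K′/ℚ_p)`" (the inertia image is
cyclic of that order for `p ≥ 5`). Literature-side form of the Summits theorem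
`Summit.BirchSwinnertonDyer.Rank1Residual.Additive.hasGoodReductionAt_baseChange_iff_semistabilityIndex_dvd`
(there for globally minimal `W` in the census currency `semistabilityIndex`).
[cite: Serre1972, §5.6 (p. 312), as quoted by MartinWatkins2006 §3.2] [cite: SilvermanAEC2009, VII.5 Prop. 5.1 and VII.1 Prop. 1.3] -/
theorem hasGoodReductionAt_baseChange_iff_twelve_div_gcd_dvd_ramificationIdx
    (hv : ((primesEquiv (R := ℤ) v : Nat.Primes) : ℕ) = p) (hp5 : 5 ≤ p) (hj : 0 ≤ padicValRat p W.j)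
    {F : Type*} [Field F] [NumberField F] (w : HeightOneSpectrum (𝓞 F)) (hw : (p : 𝓞 F) ∈ w.asIdeal) :
    (W.baseChange F).HasGoodReductionAt w ↔
      12 / Nat.gcd 12 (W.ordMinimalDiscriminant v) ∣ v.asIdeal.ramificationIdx' w.asIdeal := by
  haveI : w.asIdeal.LiesOver v.asIdeal := liesOver_of_natCast_mem_serre v hv w hw
  haveI := w.isPrime
  haveI := v.isMaximal
  rw [twelve_div_gcd_dvd_iff_twelve_dvd_mul]
  constructor
  · intro hgood
    exact W.twelve_dvd_ramificationIdx_mul_ordMinimalDiscriminant_of_hasGoodReductionAt_baseChange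
      F (v := v) (w := w) hgood
  · exact W.hasGoodReductionAt_baseChange_of_twelve_dvd_ramificationIdx_mul v hv hp5 hj w hw

/-- Above a potentially good `p ≥ 5`, "semistable at `w`" and "good at `w`" agree for `W_F`, so the
criterion also reads: **`W_F` is semistable at `w ∋ p` iff `12 / gcd(12, ord_p Δ_min) ∣ e(w ∣ p)`**
(multiplicative reduction upstairs would force `|j|_w > 1`:
`hasGoodReductionAt_baseChange_of_isSemistableAt_of_valuation_j_le_one`).
[cite: SilvermanAEC2009, VII.5 Prop. 5.1 (b) and Prop. 5.5] -/
theorem isSemistableAt_baseChange_iff_twelve_div_gcd_dvd_ramificationIdx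
    (hv : ((primesEquiv (R := ℤ) v : Nat.Primes) : ℕ) = p) (hp5 : 5 ≤ p) (hj : 0 ≤ padicValRat p W.j)
    {F : Type*} [Field F] [NumberField F] (w : HeightOneSpectrum (𝓞 F)) (hw : (p : 𝓞 F) ∈ w.asIdeal) :
    (W.baseChange F).IsSemistableAt w ↔
      12 / Nat.gcd 12 (W.ordMinimalDiscriminant v) ∣ v.asIdeal.ramificationIdx' w.asIdeal := by
  rw [← W.hasGoodReductionAt_baseChange_iff_twelve_div_gcd_dvd_ramificationIdx v hv hp5 hj w hw]
  haveI : w.asIdeal.LiesOver v.asIdeal := liesOver_of_natCast_mem_serre v hv w hw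
  have hgen : natGenerator v = p := hv
  constructor
  · intro hss
    have hjv : v.valuation ℚ W.j ≤ 1 := by
      by_cases hj0 : W.j = 0
      · rw [hj0, map_zero]; exact zero_le
      rw [valuation_eq_exp_neg_padicValRat v hj0, hgen, ← exp_zero, exp_le_exp]
      omega
    exact W.hasGoodReductionAt_baseChange_of_isSemistableAt_of_valuation_j_le_one F hjv hss
  · exact fun h ↦ Or.inl h

end Rational

/-! ## §3. Fields with an `n`-th root of `p`: `θⁿ = p` forces `n ∣ e(w ∣ p)` -/

section RootField

open Polynomial

/-- **A number field of degree `≤ n` containing an `n`-th root of a rational number `q`** (`n ≥ 1`):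
`F = ℚ[X]/(f)` for `f` the minimal polynomial of a root `θ₀ ∈ ℚ̄` of `Xⁿ − q` (`f ∣ Xⁿ − q`,
`[F : ℚ] = deg f ≤ n`; for `q = p` prime, `Xⁿ − p` is Eisenstein and the degree is `n`, which is not
needed). Private plumbing over any `q ∈ ℚ` (cf. the private lemma of
`SemistabilityDefectAtThreeTameWitnessProofs`). [folklore] -/
private theorem exists_numberField_pow_eq_algebraMap (q : ℚ) {n : ℕ} (hn : 0 < n) :
    ∃ (F : Type) (_ : Field F) (_ : NumberField F) (θ : F),
      θ ^ n = algebraMap ℚ F q ∧ Module.finrank ℚ F ≤ n := by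
  obtain ⟨θ₀, hθ₀⟩ :=
    IsAlgClosed.exists_pow_nat_eq (algebraMap ℚ (AlgebraicClosure ℚ) q) hn
  set g : ℚ[X] := X ^ n - C q with hg
  have hg0 : g ≠ 0 := X_pow_sub_C_ne_zero hn _
  have hgθ : aeval θ₀ g = 0 := by simp [hg, hθ₀]
  have halg : IsAlgebraic ℚ θ₀ := ⟨g, hg0, hgθ⟩
  have hint : _root_.IsIntegral ℚ θ₀ := halg.isIntegral
  haveI : Fact (Irreducible (minpoly ℚ θ₀)) := ⟨minpoly.irreducible hint⟩
  have hfg : minpoly ℚ θ₀ ∣ g := minpoly.dvd ℚ θ₀ hgθ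
  have hf0 : minpoly ℚ θ₀ ≠ 0 := minpoly.ne_zero hint
  refine ⟨AdjoinRoot (minpoly ℚ θ₀), inferInstance, inferInstance, AdjoinRoot.root (minpoly ℚ θ₀),
    ?_, ?_⟩
  · obtain ⟨r, hr⟩ := hfg
    have h : g.eval₂ (AdjoinRoot.of (minpoly ℚ θ₀)) (AdjoinRoot.root (minpoly ℚ θ₀)) = 0 := by
      rw [hr, eval₂_mul, AdjoinRoot.eval₂_root, zero_mul]
    rw [hg, eval₂_sub, eval₂_X_pow, eval₂_C, sub_eq_zero] at h
    exact h
  · have h1 := (AdjoinRoot.powerBasis hf0).finrank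
    have h2 : (AdjoinRoot.powerBasis hf0).dim = (minpoly ℚ θ₀).natDegree := rfl
    have h3 : (minpoly ℚ θ₀).natDegree ≤ n :=
      (natDegree_le_of_dvd hfg hg0).trans (by rw [hg, natDegree_X_pow_sub_C])
    have key : Module.finrank ℚ (AdjoinRoot (minpoly ℚ θ₀)) ≤ n := by rw [h1, h2]; exact h3
    convert key

end RootField

section RootPlace

open Rat.HeightOneSpectrum Literature.NumberTheory.EllipticCurves

variable {p : ℕ} (v : HeightOneSpectrum ℤ)

/-- **`θⁿ = p` forces `n ∣ e(w ∣ p)`** at every place `w ∋ p` of a number field `F ∋ θ` (`n ≥ 1`):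
`|θ|_wⁿ = |p|_w = |π_w|^{e(w∣p)}` in the value group `ℤₘ₀`, and `|θ|_w = |π_w|^t` for the integer
`t = −log|θ|_w`, so `e(w ∣ p) = n·t`. (Valuation bookkeeping only.) [folklore] -/
private theorem dvd_ramificationIdx_of_pow_eq_natCast (hv : ((primesEquiv (R := ℤ) v : Nat.Primes) : ℕ) = p)
    {F : Type*} [Field F] [NumberField F] {θ : F} {n : ℕ} (hn : 0 < n) (hθ : θ ^ n = p)
    (w : HeightOneSpectrum (𝓞 F)) (hw : (p : 𝓞 F) ∈ w.asIdeal) :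
    n ∣ v.asIdeal.ramificationIdx' w.asIdeal := by
  haveI : w.asIdeal.LiesOver v.asIdeal := liesOver_of_natCast_mem_serre v hv w hw
  have hgen : natGenerator v = p := hv
  have hp : p.Prime := hgen ▸ prime_natGenerator v
  set e : ℕ := v.asIdeal.ramificationIdx' w.asIdeal with he
  -- `|p|_w = exp(−e)`
  have hvp : w.valuation F (p : F) = exp (-(e : ℤ)) := by
    have h := (valuation_liesOver (K := ℚ) (L := F) v w (p : ℚ)).symm
    rw [map_natCast] at h
    rw [h, ← hgen, valuation_natGenerator_int, ← exp_nsmul, ← he, nsmul_eq_mul, mul_neg, mul_one]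
  -- `|θ|_w = exp(a)`, `n • a = −e`
  have hθ0 : θ ≠ 0 := by
    rintro rfl
    rw [zero_pow hn.ne'] at hθ
    exact hp.ne_zero (by exact_mod_cast hθ.symm)
  have hvθ0 : w.valuation F θ ≠ 0 := (Valuation.ne_zero_iff _).mpr hθ0
  set a : ℤ := log (w.valuation F θ) with ha
  have hθa : w.valuation F θ = exp a := by rw [ha, exp_log hvθ0]
  have hna : n • a = -(e : ℤ) := by
    have h : w.valuation F θ ^ n = exp (-(e : ℤ)) := by rw [← map_pow, hθ, hvp]
    rw [hθa, ← exp_nsmul] at h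
    exact exp_injective h
  refine ⟨(-a).toNat, ?_⟩
  have hnn : 0 ≤ -a := by
    have : (n : ℤ) * a = -(e : ℤ) := by simpa [nsmul_eq_mul] using hna
    nlinarith [hn, this]
  have : (e : ℤ) = n * (-a).toNat := by
    rw [Int.toNat_of_nonneg hnn]
    have : (n : ℤ) * a = -(e : ℤ) := by simpa [nsmul_eq_mul] using hna
    linarith
  exact_mod_cast this

variable (W : WeierstrassCurve ℚ) [W.IsElliptic]

/-- **Good reduction over ANY number field containing an `n`-th root of `p`, `12 ∣ n · ord_p(Δ_min)`**
(`p ≥ 5`, `ord_p j ≥ 0`, every place `w ∋ p`): `θⁿ = p` gives `n ∣ e(w ∣ p)`, hence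
`12 ∣ e(w ∣ p) · ord_p(Δ_min)`, and §2 applies. With `n = 12 / gcd(12, ord_p Δ_min)` this is
[FreitasKraus2022] Thm. 15 (1): "we can take `F = ℚ_ℓ(ℓ^{1/e})`" — `E` acquires good reduction over
`ℚ(p^{1/e})` and over every number field containing it.
[cite: FreitasKraus2022, Thm. 15 (1) (held text arXiv:1607.01218)] [cite: SilvermanAEC2009, VII.5 Prop. 5.1 (a)] -/
theorem hasGoodReductionAt_baseChange_of_pow_eq_natCast
    (hv : ((primesEquiv (R := ℤ) v : Nat.Primes) : ℕ) = p) (hp5 : 5 ≤ p) (hj : 0 ≤ padicValRat p W.j)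
    {F : Type*} [Field F] [NumberField F] {θ : F} {n : ℕ} (hn : 0 < n) (hθ : θ ^ n = p)
    (h12 : 12 ∣ n * W.ordMinimalDiscriminant v)
    (w : HeightOneSpectrum (𝓞 F)) (hw : (p : 𝓞 F) ∈ w.asIdeal) :
    (W.baseChange F).HasGoodReductionAt w := by
  obtain ⟨t, ht⟩ := dvd_ramificationIdx_of_pow_eq_natCast v hv hn hθ w hw
  refine W.hasGoodReductionAt_baseChange_of_twelve_dvd_ramificationIdx_mul v hv hp5 hj w hw ?_
  rw [ht, mul_comm n t, mul_assoc]
  exact dvd_mul_of_dvd_right h12 t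

end RootPlace

/-! ## §4. The witness of index `12 / gcd(12, ord_p Δ_min)` and Serre's formula -/

section Serre

open Rat.HeightOneSpectrum Literature.NumberTheory.EllipticCurves

variable (W : WeierstrassCurve ℚ) [W.IsElliptic] {p : ℕ} (v : HeightOneSpectrum ℤ)

/-- Every number field has a finite place above the rational prime `p`, and it lies over the place `v`
of `ℤ` with `primesEquiv v = p` (Mathlib `Ideal.exists_maximal_ideal_liesOver_of_isIntegral`; the
tame-witness file's private lemma, here with the `LiesOver` datum attached). [folklore] -/
private theorem exists_place_natCast_mem_liesOver (hv : ((primesEquiv (R := ℤ) v : Nat.Primes) : ℕ) = p)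
    (F : Type*) [Field F] [NumberField F] :
    ∃ w : HeightOneSpectrum (𝓞 F), (p : 𝓞 F) ∈ w.asIdeal ∧ w.asIdeal.LiesOver v.asIdeal := by
  have hgen : natGenerator v = p := hv
  have hp : p.Prime := hgen ▸ prime_natGenerator v
  have hp0 : Ideal.span {(p : ℤ)} ≠ ⊥ := by
    rw [Ne, Ideal.span_singleton_eq_bot]; exact_mod_cast hp.ne_zero
  haveI : (Ideal.span {(p : ℤ)}).IsMaximal :=
    ((Ideal.span_singleton_prime (by exact_mod_cast hp.ne_zero)).mpr
      (Nat.prime_iff_prime_int.mp hp)).isMaximal hp0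
  obtain ⟨Q, hQmax, hQover⟩ :=
    Ideal.exists_maximal_ideal_liesOver_of_isIntegral (S := 𝓞 F) (Ideal.span {(p : ℤ)})
  have hQ0 : Q ≠ ⊥ := Ideal.ne_bot_of_liesOver_of_ne_bot hp0 Q
  have hmem : (p : 𝓞 F) ∈ Q := by
    have h : algebraMap ℤ (𝓞 F) (p : ℤ) ∈ Q := by
      rw [← Ideal.mem_comap, ← Ideal.under_def, ← hQover.over]
      exact Ideal.mem_span_singleton_self _
    rwa [map_natCast] at h
  exact ⟨⟨Q, hQmax.isPrime, hQ0⟩, hmem, liesOver_of_natCast_mem_serre v hv ⟨Q, hQmax.isPrime, hQ0⟩ hmem⟩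

/-- **THE WITNESS OF INDEX EXACTLY `d = 12 / gcd(12, ord_p Δ_min)`** (`p ≥ 5`, `ord_p j ≥ 0`): the
number field `F = ℚ[X]/(minpoly of p^{1/d})` (`θ ∈ F`, `θ^d = p`, `[F : ℚ] ≤ d`) and any place
`w ∋ p` of `F`. `W_F` is GOOD at `w` (§3, since `d · ord_p Δ_min = 12 · ord_p Δ_min / gcd ∈ 12ℤ`), so
`d ∣ e(w ∣ p)` (lower half, `twelve_div_gcd_dvd_of_isSemistabilityWitnessAt`-style: good reduction upstairs
forces `12 ∣ e · ord_p Δ_min`), while `e(w ∣ p) ≤ [F : ℚ] ≤ d` (Mathlib `Ideal.ramificationIdx_le_finrank`);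
hence `e(w ∣ p) = d`. In print ([FreitasKraus2022] §3.3, Thm. 15 (1); Serre 1972 §5.6): "`L = ℚ_ℓ^{un}(ℓ^{1/e})`
is the minimal extension of `ℚ_ℓ^{un}` where `E` gets good reduction".
[cite: FreitasKraus2022, §3.3 and Thm. 15 (1) (held text arXiv:1607.01218)] [cite: Serre1972, §5.6 (p. 312)] -/
theorem isSemistabilityWitnessAt_twelve_div_gcd_of_five_le
    (hv : ((primesEquiv (R := ℤ) v : Nat.Primes) : ℕ) = p) (hp5 : 5 ≤ p) (hj : 0 ≤ padicValRat p W.j) :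
    W.IsSemistabilityWitnessAt p (12 / Nat.gcd 12 (W.ordMinimalDiscriminant v)) := by
  have hgen : natGenerator v = p := hv
  have hp : p.Prime := hgen ▸ prime_natGenerator v
  set d : ℕ := 12 / Nat.gcd 12 (W.ordMinimalDiscriminant v) with hd
  have hg0 : 0 < Nat.gcd 12 (W.ordMinimalDiscriminant v) := Nat.gcd_pos_of_pos_left _ (by norm_num)
  have hd0 : 0 < d := Nat.div_pos (Nat.le_of_dvd (by norm_num) (Nat.gcd_dvd_left _ _)) hg0
  -- the field `F ∋ θ`, `θ^d = p`, `[F : ℚ] ≤ d`, and a place `w ∋ p`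
  obtain ⟨F, _, _, θ, hθ, hF⟩ := exists_numberField_pow_eq_algebraMap (p : ℚ) hd0
  rw [map_natCast] at hθ
  obtain ⟨w, hw, hlies⟩ := exists_place_natCast_mem_liesOver v hv F
  haveI := hlies
  haveI := w.isPrime
  haveI := v.isMaximal
  -- good reduction at `w`: `12 ∣ d · ord_p Δ_min`
  have h12 : 12 ∣ d * W.ordMinimalDiscriminant v := by
    rw [← twelve_div_gcd_dvd_iff_twelve_dvd_mul]
  have hgood := W.hasGoodReductionAt_baseChange_of_pow_eq_natCast v hv hp5 hj hd0 hθ h12 w hw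
  -- `e(w ∣ p) = d`
  have hdvd : d ∣ v.asIdeal.ramificationIdx' w.asIdeal :=
    (W.hasGoodReductionAt_baseChange_iff_twelve_div_gcd_dvd_ramificationIdx v hv hp5 hj w hw).mp hgood
  have hle : v.asIdeal.ramificationIdx' w.asIdeal ≤ d :=
    (Ideal.ramificationIdx_le_finrank (𝓞 F) ℚ F w.asIdeal).trans hF
  have hpos : 0 < v.asIdeal.ramificationIdx' w.asIdeal :=
    Nat.pos_of_ne_zero (Ideal.IsDedekindDomain.ramificationIdx'_ne_zero_of_liesOver w.asIdeal v.ne_bot)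
  have he : v.asIdeal.ramificationIdx' w.asIdeal = d :=
    le_antisymm hle (Nat.le_of_dvd hpos hdvd)
  refine ⟨F, inferInstance, inferInstance, w, hw, ?_, Or.inl hgood⟩
  rw [← Ideal.ramificationIdx'_eq_ramificationIdx v.asIdeal w.asIdeal v.ne_bot]
  exact he

/-- **SERRE'S FORMULA, PROVED: at a prime `p ≥ 5` with `ord_p j ≥ 0` the semistability defect of an
elliptic `W/ℚ` is EXACTLY `12 / gcd(12, ord_p Δ_min)`** (`= |Φ_p|`, the order of the inertia image on
`E[ℓ]`; Serre 1972 §5.6: "`Φ = C_d` where `d = 12/gcd(12, v_p(Δ_E))`"). Upper bound: the witness of index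
`d` above (`semistabilityDefectAt_le`); lower bound: `d ∣ defect`
(`twelve_div_gcd_ordMinimalDiscriminant_dvd_semistabilityDefectAt`) and `defect > 0`. Values: `1` for
good reduction (`ord_p Δ_min = 0`), and `6, 4, 3, 2, 3, 4, 6` for `ord_p Δ_min = 2, 3, 4, 6, 8, 9, 10`
(Kodaira II, III, IV, I₀*, IV*, III*, II*). At `p = 2, 3` the statement is FALSE in general (Kraus 1990)
and is not asserted. [cite: Serre1972, §5.6 (p. 312), as quoted by MartinWatkins2006 §3.2 ("Φ = C_d where d = 12/gcd(12, v_p(Δ_E))")]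
[cite: Kraus1990, §1 (the case p ≥ 5 of the défaut de semi-stabilité), as recalled in FreitasKraus2022 §3.3] -/
theorem semistabilityDefectAt_eq_twelve_div_gcd_of_five_le
    (hv : ((primesEquiv (R := ℤ) v : Nat.Primes) : ℕ) = p) (hp5 : 5 ≤ p) (hj : 0 ≤ padicValRat p W.j) :
    W.semistabilityDefectAt p = 12 / Nat.gcd 12 (W.ordMinimalDiscriminant v) := by
  have hwit := W.isSemistabilityWitnessAt_twelve_div_gcd_of_five_le v hv hp5 hj
  have hle := semistabilityDefectAt_le hwit
  have hpos : 0 < W.semistabilityDefectAt p := semistabilityDefectAt_pos_of_witness hwit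
  have hdvd := W.twelve_div_gcd_ordMinimalDiscriminant_dvd_semistabilityDefectAt v hv hj
  exact le_antisymm hle (Nat.le_of_dvd hpos hdvd)

/-- At `p ≥ 5` with `ord_p j ≥ 0` a semistability witness EXISTS, i.e. the defect is not the junk
value `0` (the semistable reduction theorem, Silverman *AEC* VII.5.4, on this class — by the explicit
field `ℚ(p^{1/d})`). [cite: SilvermanAEC2009, VII.5 Prop. 5.4] -/
theorem semistabilityDefectAt_pos_of_five_le
    (hv : ((primesEquiv (R := ℤ) v : Nat.Primes) : ℕ) = p) (hp5 : 5 ≤ p) (hj : 0 ≤ padicValRat p W.j) :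
    0 < W.semistabilityDefectAt p :=
  semistabilityDefectAt_pos_of_witness (W.isSemistabilityWitnessAt_twelve_div_gcd_of_five_le v hv hp5 hj)

omit [W.IsElliptic] in
/-- `12 / gcd(12, m)` divides `12`. [folklore] -/
private theorem twelve_div_gcd_dvd_twelve (m : ℕ) : 12 / Nat.gcd 12 m ∣ 12 :=
  Nat.div_dvd_of_dvd (Nat.gcd_dvd_left 12 m)

/-- **The defect at `p ≥ 5` divides `12`** (it is `12 / gcd(12, ord_p Δ_min)`; in print: `Φ_p` is a
cyclic group of order dividing `12` because `Aut(Ẽ) ↩ Φ_p` has order dividing `12` in characteristic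
`≥ 5`, Serre 1972 §5.6). [cite: Serre1972, §5.6 (p. 312)] -/
theorem semistabilityDefectAt_dvd_twelve_of_five_le
    (hv : ((primesEquiv (R := ℤ) v : Nat.Primes) : ℕ) = p) (hp5 : 5 ≤ p) (hj : 0 ≤ padicValRat p W.j) :
    W.semistabilityDefectAt p ∣ 12 := by
  rw [W.semistabilityDefectAt_eq_twelve_div_gcd_of_five_le v hv hp5 hj]
  exact twelve_div_gcd_dvd_twelve _

/-- **The defect, not only Serre's number, divides every witness index** (`p ≥ 5`, `ord_p j ≥ 0`): if a
number field semistabilises `E` at a place of ramification index `e` above `p`, then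
`W.semistabilityDefectAt p ∣ e` — the minimal field `L` of good reduction is contained in every field of
good reduction (Coppola 2020 §2), read through ramification indices.
[cite: Coppola2020, §2 (minimality of L, paragraph before Lemma 2.6)] [cite: Serre1972, §5.6 (p. 312)] -/
theorem semistabilityDefectAt_dvd_of_isSemistabilityWitnessAt_of_five_le
    (hv : ((primesEquiv (R := ℤ) v : Nat.Primes) : ℕ) = p) (hp5 : 5 ≤ p) (hj : 0 ≤ padicValRat p W.j)
    {e : ℕ} (he : W.IsSemistabilityWitnessAt p e) : W.semistabilityDefectAt p ∣ e := by
  rw [W.semistabilityDefectAt_eq_twelve_div_gcd_of_five_le v hv hp5 hj]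
  exact W.twelve_div_gcd_dvd_of_isSemistabilityWitnessAt v hv hj he

/-- **The criterion in terms of the defect** (`p ≥ 5`, `ord_p j ≥ 0`, any number field `F`, any place
`w ∋ p`): `W_F` is semistable (equivalently good) at `w` iff `W.semistabilityDefectAt p ∣ e(w ∣ p)` —
Serre–Tate's criterion with Kraus's invariant, as a theorem of the tree.
[cite: Serre1972, §5.6 (p. 312)] [cite: Coppola2020, §2 (definition of L)] -/
theorem isSemistableAt_baseChange_iff_semistabilityDefectAt_dvd_ramificationIdx
    (hv : ((primesEquiv (R := ℤ) v : Nat.Primes) : ℕ) = p) (hp5 : 5 ≤ p) (hj : 0 ≤ padicValRat p W.j)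
    {F : Type*} [Field F] [NumberField F] (w : HeightOneSpectrum (𝓞 F)) (hw : (p : 𝓞 F) ∈ w.asIdeal) :
    (W.baseChange F).IsSemistableAt w ↔
      W.semistabilityDefectAt p ∣ v.asIdeal.ramificationIdx' w.asIdeal := by
  rw [W.semistabilityDefectAt_eq_twelve_div_gcd_of_five_le v hv hp5 hj]
  exact W.isSemistableAt_baseChange_iff_twelve_div_gcd_dvd_ramificationIdx v hv hp5 hj w hw

/-- **Every number field containing a `d`-th root of `p`, `d` the defect, semistabilises `E` at every
place above `p`** (`p ≥ 5`, `ord_p j ≥ 0`; [FreitasKraus2022] Thm. 15 (1): "we can take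
`F = ℚ_ℓ(ℓ^{1/e})`"). [cite: FreitasKraus2022, Thm. 15 (1) (held text arXiv:1607.01218)] -/
theorem hasGoodReductionAt_baseChange_of_pow_semistabilityDefectAt_eq_natCast
    (hv : ((primesEquiv (R := ℤ) v : Nat.Primes) : ℕ) = p) (hp5 : 5 ≤ p) (hj : 0 ≤ padicValRat p W.j)
    {F : Type*} [Field F] [NumberField F] {θ : F} (hθ : θ ^ W.semistabilityDefectAt p = p)
    (w : HeightOneSpectrum (𝓞 F)) (hw : (p : 𝓞 F) ∈ w.asIdeal) :
    (W.baseChange F).HasGoodReductionAt w := by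
  rw [W.semistabilityDefectAt_eq_twelve_div_gcd_of_five_le v hv hp5 hj] at hθ
  have hg0 : 0 < Nat.gcd 12 (W.ordMinimalDiscriminant v) := Nat.gcd_pos_of_pos_left _ (by norm_num)
  have hd0 : 0 < 12 / Nat.gcd 12 (W.ordMinimalDiscriminant v) :=
    Nat.div_pos (Nat.le_of_dvd (by norm_num) (Nat.gcd_dvd_left _ _)) hg0
  refine W.hasGoodReductionAt_baseChange_of_pow_eq_natCast v hv hp5 hj hd0 hθ ?_ w hw
  rw [← twelve_div_gcd_dvd_iff_twelve_dvd_mul]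

end Serre

/-! ## §5. The `p`-adic currency: Serre's number on the chosen `ℤ_p`-minimal model (Rohrlich's `e`)
and on a global minimal equation -/

section PadicCurrency

open Rat.HeightOneSpectrum Literature.NumberTheory.EllipticCurves IsDiscreteValuationRing

variable (W : WeierstrassCurve ℚ) [W.IsElliptic] {p : ℕ} [Fact p.Prime] (v : HeightOneSpectrum ℤ)

omit [W.IsElliptic] in
/-- **`ord_p(Δ_min) = ord Δ(X)` for the chosen `ℤ_p`-minimal model `X = (W ⊗ ℚ_p).minimal ℤ_p`** (the
currency of `RootNumber.lean`): the tree's transport lemma `ordMinimalDiscriminant_eq_padic`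
(`v.adicCompletion ℚ ≃ ℚ_[p]`, Silverman *AEC* VII.1 Prop. 1.3 (b): all minimal equations have the same
`ord Δ`) at a NAMED prime `p = primesEquiv v`. [cite: SilvermanAEC2009, VII.1 Prop. 1.3 (b)] -/
theorem ordMinimalDiscriminant_eq_toNat_addVal_minimal_padic
    (hv : ((primesEquiv (R := ℤ) v : Nat.Primes) : ℕ) = p) :
    W.ordMinimalDiscriminant v =
      (addVal ℤ_[p] (((W.baseChange ℚ_[p]).minimal ℤ_[p]).integralModel ℤ_[p]).Δ).toNat := by
  subst hv
  exact W.ordMinimalDiscriminant_eq_padic v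

omit [W.IsElliptic] in
/-- In `ℤ_p` the normalised additive valuation of a nonzero element is Mathlib's `PadicInt.valuation`
(`x = u · p^{valuation x}`, `PadicInt.unitCoeff_spec`). [folklore] -/
private theorem addVal_padicInt_eq_valuation {x : ℤ_[p]} (hx : x ≠ 0) :
    addVal ℤ_[p] x = x.valuation :=
  addVal_def x (PadicInt.unitCoeff hx) PadicInt.irreducible_p _ (PadicInt.unitCoeff_spec hx)

/-- **The potentially-good test of Rohrlich's case list is `ord_p j ≥ 0`**: for the chosen `ℤ_p`-minimal
model `X` of `W ⊗ ℚ_p`, `0 ≤ ord_p j(W) ↔ ¬ 3·ord c₄(X) < ord Δ(X)` (`j = c₄³/Δ` is an invariant of the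
curve; Silverman *AEC* VII.5 Prop. 5.5: potentially good iff `j` integral; Rohrlich, Compositio 87 (1993)
Prop. 2 (iii)/(iv): the branch `v(j) < 0` / `v(j) ≥ 0`). With `c₄(X) = 0` both sides hold
(`3·⊤ = ⊤ ≮ ord Δ`, `j = 0`). [cite: SilvermanAEC2009, VII.5 Prop. 5.5] [cite: Rohrlich1993Compositio, Prop. 2 (iii)–(iv)] -/
theorem padicValRat_j_nonneg_iff_not_addVal_lt :
    0 ≤ padicValRat p W.j ↔
      ¬ 3 * addVal ℤ_[p] (((W.baseChange ℚ_[p]).minimal ℤ_[p]).integralModel ℤ_[p]).c₄ <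
        addVal ℤ_[p] (((W.baseChange ℚ_[p]).minimal ℤ_[p]).integralModel ℤ_[p]).Δ := by
  haveI hWpE : (W.baseChange ℚ_[p]).IsElliptic := by change (W.map _).IsElliptic; infer_instance
  haveI hXell : ((W.baseChange ℚ_[p]).minimal ℤ_[p]).IsElliptic := by unfold minimal; infer_instance
  -- `j(X) = j(W)` in `ℚ_p` (the chosen minimal model is a `ℚ_p`-isomorphic equation)
  have hjX : ((W.baseChange ℚ_[p]).minimal ℤ_[p]).j = (W.j : ℚ_[p]) :=
    ((W.baseChange ℚ_[p]).variableChange_j ((W.baseChange ℚ_[p]).exists_isMinimal ℤ_[p]).choose).trans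
      ((W.map_j (algebraMap ℚ ℚ_[p])).trans (eq_ratCast _ _))
  set X := (W.baseChange ℚ_[p]).minimal ℤ_[p] with hX
  set I := X.integralModel ℤ_[p] with hI
  have hc₄ : algebraMap ℤ_[p] ℚ_[p] I.c₄ = X.c₄ := integralModel_c₄_eq ℤ_[p] X
  have hΔ : algebraMap ℤ_[p] ℚ_[p] I.Δ = X.Δ := integralModel_Δ_eq ℤ_[p] X
  have hXΔ0 : X.Δ ≠ 0 := X.isUnit_Δ.ne_zero
  have hIΔ0 : I.Δ ≠ 0 := fun h0 ↦ hXΔ0 (by rw [← hΔ, h0, map_zero])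
  have hvΔ : addVal ℤ_[p] I.Δ = (I.Δ.valuation : ℕ∞) := addVal_padicInt_eq_valuation hIΔ0
  have h3top : (3 : ℕ∞) * ⊤ = ⊤ := WithTop.mul_top three_ne_zero
  by_cases hc0 : I.c₄ = 0
  · -- `c₄ = 0`: `j = 0` and `3 · ⊤ = ⊤` is not `< ord Δ`
    have hXc : X.c₄ = 0 := by rw [← hc₄, hc0, map_zero]
    have hj0 : W.j = 0 := by
      have : (W.j : ℚ_[p]) = 0 := by
        rw [← hjX, WeierstrassCurve.j, hXc, zero_pow three_ne_zero, mul_zero]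
      exact_mod_cast this
    rw [hj0, padicValRat.zero, hc0, addVal_zero, hvΔ, h3top]
    simp
  · have hvc : addVal ℤ_[p] I.c₄ = (I.c₄.valuation : ℕ∞) := addVal_padicInt_eq_valuation hc0
    have hXc0 : X.c₄ ≠ 0 := by
      rw [← hc₄]
      exact fun h ↦ hc0 ((map_eq_zero_iff _ (IsFractionRing.injective ℤ_[p] ℚ_[p])).mp h)
    have hvalΔ : (X.Δ).valuation = (I.Δ.valuation : ℤ) := by
      rw [← hΔ, PadicInt.algebraMap_apply, PadicInt.valuation_coe]
    have hvalc : (X.c₄).valuation = (I.c₄.valuation : ℤ) := by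
      rw [← hc₄, PadicInt.algebraMap_apply, PadicInt.valuation_coe]
    -- `ord_p j = 3 ord c₄(X) − ord Δ(X)`
    have hval : padicValRat p W.j = 3 * (I.c₄.valuation : ℤ) - (I.Δ.valuation : ℤ) := by
      rw [← Padic.valuation_ratCast, ← hjX, WeierstrassCurve.j, Units.val_inv_eq_inv_val, coe_Δ',
        Padic.valuation_mul (inv_ne_zero hXΔ0) (pow_ne_zero _ hXc0), Padic.valuation_inv,
        Padic.valuation_pow, hvalΔ, hvalc]
      ring
    rw [hval, hvc, hvΔ]
    have hcast : (3 : ℕ∞) * (I.c₄.valuation : ℕ∞) = ((3 * I.c₄.valuation : ℕ) : ℕ∞) := by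
      push_cast; ring
    rw [hcast, Nat.cast_lt]
    omega

/-- **ROHRLICH'S `e` IS KRAUS'S DEFECT (`p ≥ 5`, potentially good).** For the chosen `ℤ_p`-minimal model
`X` of `W ⊗ ℚ_p` with `¬ 3·ord c₄(X) < ord Δ(X)`: `W.semistabilityDefectAt p = 12 / gcd(ord Δ(X), 12)` —
the number `e` of branch 6 of the tree's `localRootNumber` case list (Rohrlich, Compositio 87 (1993)
Prop. 2 (iv): "`e = 12/gcd(v(Δ), 12)` … the order of `Φ`") equals the defect of `SemistabilityDefect.lean`.
[cite: Rohrlich1993Compositio, Prop. 2 (iv)] [cite: Serre1972, §5.6 (p. 312)] -/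
theorem semistabilityDefectAt_eq_twelve_div_gcd_addVal_of_five_le (hp5 : 5 ≤ p)
    (hj : ¬ 3 * addVal ℤ_[p] (((W.baseChange ℚ_[p]).minimal ℤ_[p]).integralModel ℤ_[p]).c₄ <
      addVal ℤ_[p] (((W.baseChange ℚ_[p]).minimal ℤ_[p]).integralModel ℤ_[p]).Δ) :
    W.semistabilityDefectAt p =
      12 / Nat.gcd (addVal ℤ_[p] (((W.baseChange ℚ_[p]).minimal ℤ_[p]).integralModel ℤ_[p]).Δ).toNat 12 := by
  have hp : p.Prime := Fact.out
  set v : HeightOneSpectrum ℤ := (primesEquiv (R := ℤ)).symm ⟨p, hp⟩ with hvdef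
  have hv : ((primesEquiv (R := ℤ) v : Nat.Primes) : ℕ) = p :=
    congrArg Subtype.val ((primesEquiv (R := ℤ)).apply_symm_apply ⟨p, hp⟩)
  rw [W.semistabilityDefectAt_eq_twelve_div_gcd_of_five_le v hv hp5
    ((W.padicValRat_j_nonneg_iff_not_addVal_lt).mpr hj), Nat.gcd_comm,
    W.ordMinimalDiscriminant_eq_toNat_addVal_minimal_padic v hv]

/-- The same with a named exponent `ord Δ(X) = a` (the hypothesis shape of the sign-law files of route
`AdditiveKolyvaginRoad`): `W.semistabilityDefectAt p = 12 / gcd(a, 12)`; so `e ∤ p − 1` / `e ∣ p − 1`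
there may be read with `e := W.semistabilityDefectAt p`. [cite: Rohrlich1993Compositio, Prop. 2 (iv)] [cite: Serre1972, §5.6 (p. 312)] -/
theorem semistabilityDefectAt_eq_twelve_div_gcd_of_addVal_eq (hp5 : 5 ≤ p) {a : ℕ}
    (hΔ : addVal ℤ_[p] (((W.baseChange ℚ_[p]).minimal ℤ_[p]).integralModel ℤ_[p]).Δ = a)
    (hj : ¬ 3 * addVal ℤ_[p] (((W.baseChange ℚ_[p]).minimal ℤ_[p]).integralModel ℤ_[p]).c₄ <
      addVal ℤ_[p] (((W.baseChange ℚ_[p]).minimal ℤ_[p]).integralModel ℤ_[p]).Δ) :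
    W.semistabilityDefectAt p = 12 / Nat.gcd a 12 := by
  rw [W.semistabilityDefectAt_eq_twelve_div_gcd_addVal_of_five_le hp5 hj, hΔ, ENat.toNat_coe]

/-- The same with the hypothesis `0 ≤ ord_p j` of §4. [cite: Rohrlich1993Compositio, Prop. 2 (iv)] [cite: Serre1972, §5.6 (p. 312)] -/
theorem semistabilityDefectAt_eq_twelve_div_gcd_addVal_of_padicValRat_nonneg (hp5 : 5 ≤ p)
    (hj : 0 ≤ padicValRat p W.j) :
    W.semistabilityDefectAt p =
      12 / Nat.gcd (addVal ℤ_[p] (((W.baseChange ℚ_[p]).minimal ℤ_[p]).integralModel ℤ_[p]).Δ).toNat 12 :=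
  W.semistabilityDefectAt_eq_twelve_div_gcd_addVal_of_five_le hp5
    ((W.padicValRat_j_nonneg_iff_not_addVal_lt).mp hj)

/-- **Serre's formula on a GLOBAL MINIMAL EQUATION** (`W` globally minimal, `p ≥ 5`, `ord_p j ≥ 0`):
`W.semistabilityDefectAt p = 12 / gcd(12, ord_p Δ_min(E))` with `Δ_min(E) = W.minimalDiscriminantInt`
(Silverman *AEC* VIII.8: a global minimal equation is minimal at every prime; the tree's
`ordMinimalDiscriminant_eq_padicValInt_natGenerator'`). The right-hand side is, verbatim, the census
index `semistabilityIndex W p` of `Summits/BirchSwinnertonDyer/Rank1Residual/Additive/SharpenedStatements.lean`.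
[cite: Serre1972, §5.6 (p. 312)] [cite: SilvermanAEC2009, VIII.8 (global minimal equations)] -/
theorem semistabilityDefectAt_eq_twelve_div_gcd_padicValInt_of_five_le [W.IsGloballyMinimal]
    (hp5 : 5 ≤ p) (hj : 0 ≤ padicValRat p W.j) :
    W.semistabilityDefectAt p = 12 / Nat.gcd 12 (padicValInt p W.minimalDiscriminantInt) := by
  have hp : p.Prime := Fact.out
  set v : HeightOneSpectrum ℤ := (primesEquiv (R := ℤ)).symm ⟨p, hp⟩ with hvdef
  have hv : ((primesEquiv (R := ℤ) v : Nat.Primes) : ℕ) = p :=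
    congrArg Subtype.val ((primesEquiv (R := ℤ)).apply_symm_apply ⟨p, hp⟩)
  have hgen : natGenerator v = p := hv
  rw [W.semistabilityDefectAt_eq_twelve_div_gcd_of_five_le v hv hp5 hj,
    W.ordMinimalDiscriminant_eq_padicValInt_natGenerator' v, hgen]

end PadicCurrency

/-! ## §6. The unit-`c₄` criterion: `|j|_v ≥ 1` and `|c₄|_v ∈ (value group)⁴` give semistable reduction
(multiplicative if `|j|_v > 1`) at a place `v ∤ 6` -/

section UnitC4

variable {A : Type*} [CommRing A] [IsDedekindDomain A] {K : Type*} [Field K] [Algebra A K]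
  [IsFractionRing A K] (v : HeightOneSpectrum A) (V : WeierstrassCurve K) [V.IsElliptic]

/-- **Semistable reduction at a place `v ∤ 6` from `|j|_v ≥ 1` and `|c₄|_v = |δ|_v⁴`** (Silverman *AEC*
VII.5 Prop. 5.1 (b) with Remark VII.1.1; the potentially multiplicative companion of
`hasGoodReductionAt_of_valuation_j_le_one_of_exists_pow_twelve`): rescaling by `δ` makes `c₄` a `v`-unit,
then `|Δ₁| = |j|⁻¹ ≤ 1`, `|c₆|² ≤ max(|c₄|³, |1728 Δ₁|) ≤ 1`, so the short Weierstrass form (`2, 3 ∈ O_vˣ`) is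
`v`-integral with unit `c₄`: semistable (`isSemistableAt_of_valuation_c₄_eq_one` — good if `|Δ₁| = 1`,
multiplicative otherwise). Stated over the fraction field of any Dedekind domain.
[cite: SilvermanAEC2009, VII.5 Prop. 5.1 (b) and VII.1 Remark 1.1] -/
theorem isSemistableAt_of_one_le_valuation_j_of_exists_pow_four
    (h2 : v.valuation K (2 : K) = 1) (h3 : v.valuation K (3 : K) = 1) (hj : 1 ≤ v.valuation K V.j)
    (hδ : ∃ δ : K, v.valuation K δ ^ 4 = v.valuation K V.c₄) : V.IsSemistableAt v := by
  obtain ⟨δ, hδ⟩ := hδ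
  have h20 : (2 : K) ≠ 0 := fun h ↦ by rw [h, map_zero] at h2; exact zero_ne_one h2
  have h30 : (3 : K) ≠ 0 := fun h ↦ by rw [h, map_zero] at h3; exact zero_ne_one h3
  have h48 : v.valuation K (48 : K) = 1 := by
    rw [show (48 : K) = 2 ^ 4 * 3 by norm_num, map_mul, map_pow, h2, h3]; simp
  have h864 : v.valuation K (864 : K) = 1 := by
    rw [show (864 : K) = 2 ^ 5 * 3 ^ 3 by norm_num, map_mul, map_pow, map_pow, h2, h3]; simp
  have h1728 : v.valuation K (1728 : K) = 1 := by
    rw [show (1728 : K) = 2 ^ 6 * 3 ^ 3 by norm_num, map_mul, map_pow, map_pow, h2, h3]; simp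
  -- `c₄ ≠ 0`, `δ ≠ 0`, `j ≠ 0`
  have hc40 : V.c₄ ≠ 0 := by
    intro h0
    have : V.j = 0 := by rw [WeierstrassCurve.j, h0, zero_pow three_ne_zero, mul_zero]
    rw [this, map_zero] at hj
    exact not_lt.mpr hj zero_lt_one
  have hδ0 : δ ≠ 0 := by
    rintro rfl
    rw [map_zero, zero_pow (by norm_num)] at hδ
    exact hc40 ((map_eq_zero _).mp hδ.symm)
  have hvδ : v.valuation K δ ≠ 0 := (Valuation.ne_zero_iff _).mpr hδ0
  have hvj0 : v.valuation K V.j ≠ 0 := ne_of_gt (lt_of_lt_of_le zero_lt_one hj)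
  -- rescale by `δ`: `c₄(W₁)` is a `v`-unit
  set C₁ : VariableChange K := ⟨Units.mk0 δ hδ0, 0, 0, 0⟩ with hC₁
  set W₁ := C₁ • V with hW₁
  haveI hW₁ell : W₁.IsElliptic := inferInstanceAs (C₁ • V).IsElliptic
  have hC₁u : (↑C₁.u⁻¹ : K) = δ⁻¹ := by rw [Units.val_inv_eq_inv_val, hC₁, Units.val_mk0]
  have hc₄₁ : W₁.c₄ = δ⁻¹ ^ 4 * V.c₄ := by rw [hW₁, variableChange_c₄, hC₁u]
  have hvc₄₁ : v.valuation K W₁.c₄ = 1 := by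
    rw [hc₄₁, map_mul, map_pow, map_inv₀, ← hδ, inv_pow, inv_mul_cancel₀ (pow_ne_zero _ hvδ)]
  have hj₁ : W₁.j = V.j := V.variableChange_j C₁
  have hc4cube : W₁.c₄ ^ 3 = W₁.j * W₁.Δ := by
    rw [WeierstrassCurve.j, ← coe_Δ', mul_comm (↑W₁.Δ'⁻¹ : K), mul_assoc, Units.inv_mul, mul_one]
  -- `|Δ₁| = |j|⁻¹ ≤ 1`
  have hvΔ₁ : v.valuation K W₁.Δ ≤ 1 := by
    have h := congrArg (v.valuation K) hc4cube
    rw [map_pow, hvc₄₁, one_pow, map_mul, hj₁] at h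
    rw [← inv_eq_of_mul_eq_one_right h.symm]
    exact (inv_le_one₀ (lt_of_lt_of_le zero_lt_one hj)).mpr hj
  have hc6 : v.valuation K W₁.c₆ ≤ 1 := by
    have hrel : W₁.c₆ ^ 2 = W₁.c₄ ^ 3 - 1728 * W₁.Δ := by rw [c_relation]; ring
    rw [← pow_le_one_iff two_ne_zero, ← map_pow, hrel]
    refine le_trans (Valuation.map_sub _ _ _) (max_le ?_ ?_)
    · rw [map_pow, hvc₄₁, one_pow]
    · rw [map_mul, h1728, one_mul]; exact hvΔ₁
  -- the short Weierstrass form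
  letI : Invertible (2 : K) := invertibleOfNonzero h20
  letI : Invertible (3 : K) := invertibleOfNonzero h30
  set S := W₁.toShortNF • W₁ with hS
  haveI : S.IsShortNF := W₁.toShortNF_spec
  haveI hSell : S.IsElliptic := inferInstanceAs (W₁.toShortNF • W₁).IsElliptic
  have hSu : W₁.toShortNF.u = 1 := by
    simp [toShortNF, toCharNeTwoNF, VariableChange.mul_def]
  have hSu' : (↑W₁.toShortNF.u⁻¹ : K) = 1 := by rw [hSu, inv_one, Units.val_one]
  have hSc4 : S.c₄ = W₁.c₄ := by rw [hS, variableChange_c₄, hSu', one_pow, one_mul]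
  have hSc6 : S.c₆ = W₁.c₆ := by rw [hS, variableChange_c₆, hSu', one_pow, one_mul]
  have ha4 : v.valuation K S.a₄ ≤ 1 := by
    have h : v.valuation K S.a₄ = v.valuation K S.c₄ := by
      rw [S.c₄_of_isShortNF, map_mul, Valuation.map_neg, h48, one_mul]
    rw [h, hSc4, hvc₄₁]
  have ha6 : v.valuation K S.a₆ ≤ 1 := by
    have h : v.valuation K S.a₆ = v.valuation K S.c₆ := by
      rw [S.c₆_of_isShortNF, map_mul, Valuation.map_neg, h864, one_mul]
    rw [h, hSc6]; exact hc6
  have hSint : S.IsIntegralAt v :=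
    S.isIntegralAt_of_valuation_le_one v
      (by rw [S.a₁_of_isShortNF, map_zero]; exact zero_le)
      (by rw [S.a₂_of_isShortNF, map_zero]; exact zero_le)
      (by rw [S.a₃_of_isShortNF, map_zero]; exact zero_le) ha4 ha6
  have hSss : S.IsSemistableAt v :=
    isSemistableAt_of_valuation_c₄_eq_one hSint (by rw [hSc4, hvc₄₁])
  have h1 : W₁.IsSemistableAt v := (isSemistableAt_smul_iff_holds v W₁ W₁.toShortNF).mp hSss
  exact (isSemistableAt_smul_iff_holds v V C₁).mp h1

end UnitC4

/-! ## §7. The potentially multiplicative rows at `p ≥ 5`: `ord_p j < 0` -/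

section PotMult

open Rat.HeightOneSpectrum Literature.NumberTheory.EllipticCurves

variable (W : WeierstrassCurve ℚ) [W.IsElliptic] {p : ℕ} (v : HeightOneSpectrum ℤ)

/-- **`ord_p j < 0` forces `c₄ ≠ 0`, `ord_p j = 3 ord_p c₄ − ord_p Δ` and `2 ∣ ord_p c₄`** (`p ≥ 5`, ANY
equation `W`): `j = c₄³/Δ`, and in `c₆² = c₄³ − 1728 Δ` the two terms on the right have the distinct
valuations `3 ord_p c₄ < ord_p Δ` (`p ∤ 1728`), so `2 ord_p c₆ = 3 ord_p c₄` (Silverman *AEC* VII.5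
Prop. 5.1 (b)/(c): on a minimal model this is `ord c₄ = 2, ord c₆ = 3`, Kodaira `Iₙ*`; here for an
arbitrary equation). [cite: SilvermanAEC2009, VII.5 Prop. 5.1 and Prop. 5.5] -/
theorem c₄_ne_zero_and_even_padicValRat_c₄_of_padicValRat_j_neg (hp : p.Prime) (hp5 : 5 ≤ p)
    (hj : padicValRat p W.j < 0) :
    W.c₄ ≠ 0 ∧ padicValRat p W.j = 3 * padicValRat p W.c₄ - padicValRat p W.Δ ∧
      (2 : ℤ) ∣ padicValRat p W.c₄ := by
  haveI : Fact p.Prime := ⟨hp⟩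
  have hΔ0 : W.Δ ≠ 0 := W.isUnit_Δ.ne_zero
  have hc40 : W.c₄ ≠ 0 := by
    intro h0
    have : W.j = 0 := by rw [WeierstrassCurve.j, h0, zero_pow three_ne_zero, mul_zero]
    rw [this, padicValRat.zero] at hj
    exact lt_irrefl _ hj
  have hjval : padicValRat p W.j = 3 * padicValRat p W.c₄ - padicValRat p W.Δ := by
    rw [WeierstrassCurve.j, Units.val_inv_eq_inv_val, coe_Δ',
      padicValRat.mul (inv_ne_zero hΔ0) (pow_ne_zero _ hc40), padicValRat.inv, padicValRat.pow W.c₄]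
    push_cast; ring
  refine ⟨hc40, hjval, ?_⟩
  -- `2 ord c₆ = 3 ord c₄`
  have h1728 : padicValRat p (1728 : ℚ) = 0 := by
    rw [show (1728 : ℚ) = ((1728 : ℕ) : ℚ) by norm_num, padicValRat.of_nat]
    norm_cast
    refine padicValNat.eq_zero_of_not_dvd ?_
    intro h
    have : p ∣ 2 ^ 6 * 3 ^ 3 := by simpa using h
    rcases (Nat.Prime.dvd_mul hp).mp this with h | h
    · have := (Nat.prime_dvd_prime_iff_eq hp Nat.prime_two).mp (hp.dvd_of_dvd_pow h); omega
    · have := (Nat.prime_dvd_prime_iff_eq hp Nat.prime_three).mp (hp.dvd_of_dvd_pow h); omega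
  have hlt : padicValRat p (W.c₄ ^ 3) < padicValRat p (1728 * W.Δ) := by
    rw [padicValRat.pow W.c₄, padicValRat.mul (by norm_num) hΔ0, h1728]; push_cast; linarith
  have hrel : W.c₆ ^ 2 = W.c₄ ^ 3 - 1728 * W.Δ := by rw [c_relation]; ring
  have hc60 : W.c₆ ≠ 0 := by
    intro h0
    rw [h0, zero_pow two_ne_zero, eq_comm, sub_eq_zero] at hrel
    rw [hrel] at hlt
    exact lt_irrefl _ hlt
  have hsq : padicValRat p (W.c₆ ^ 2) = padicValRat p (W.c₄ ^ 3) := by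
    apply le_antisymm
    · -- `c₄³ = c₆² + 1728Δ`: `min(v c₆², v(1728Δ)) ≤ v c₄³ < v(1728Δ)`
      by_contra hgt
      push Not at hgt
      have hsum : W.c₆ ^ 2 + 1728 * W.Δ = W.c₄ ^ 3 := by rw [hrel]; ring
      have hmin := padicValRat.min_le_padicValRat_add (p := p) (q := W.c₆ ^ 2) (r := 1728 * W.Δ)
        (by rw [hsum]; exact pow_ne_zero _ hc40)
      rw [hsum] at hmin
      have : min (padicValRat p (W.c₆ ^ 2)) (padicValRat p (1728 * W.Δ)) > padicValRat p (W.c₄ ^ 3) :=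
        lt_min hgt hlt
      linarith
    · -- `c₆² = c₄³ + (−1728Δ)`: `v c₆² ≥ min = v c₄³`
      have hsum : W.c₄ ^ 3 + -(1728 * W.Δ) = W.c₆ ^ 2 := by rw [hrel]; ring
      have hmin := padicValRat.min_le_padicValRat_add (p := p) (q := W.c₄ ^ 3) (r := -(1728 * W.Δ))
        (by rw [hsum]; exact pow_ne_zero _ hc60)
      rw [hsum, padicValRat.neg, min_eq_left hlt.le] at hmin
      exact hmin
  rw [padicValRat.pow W.c₆, padicValRat.pow W.c₄] at hsq
  push_cast at hsq
  exact ⟨padicValRat p W.c₆ - padicValRat p W.c₄, by linarith⟩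

/-- **Over `ℚ` itself: `ord_p j < 0` and `4 ∣ ord_p c₄` give SEMISTABLE (multiplicative) reduction at
`p ≥ 5`** (`δ = p^{ord_p c₄ / 4} ∈ ℚ` in the unit-`c₄` criterion; so at an ADDITIVE potentially
multiplicative prime `ord_p c₄ ≡ 2 (mod 4)` for every equation — on a minimal model `ord_p c₄ = 2`,
Kodaira `Iₙ*`). [cite: SilvermanAEC2009, VII.5 Prop. 5.1 (b),(c)] -/
theorem isSemistableAt_of_padicValRat_j_neg_of_four_dvd
    (hv : ((primesEquiv (R := ℤ) v : Nat.Primes) : ℕ) = p) (hp5 : 5 ≤ p)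
    (hj : padicValRat p W.j < 0) (h4 : (4 : ℤ) ∣ padicValRat p W.c₄) : W.IsSemistableAt v := by
  have hgen : natGenerator v = p := hv
  have hp : p.Prime := hgen ▸ prime_natGenerator v
  haveI : Fact p.Prime := ⟨hp⟩
  obtain ⟨hc40, -, -⟩ := W.c₄_ne_zero_and_even_padicValRat_c₄_of_padicValRat_j_neg hp hp5 hj
  have hnat : ∀ q : ℕ, q ≠ 0 → ¬ p ∣ q → v.valuation ℚ (q : ℚ) = 1 := by
    intro q hq0 hpq
    rw [valuation_eq_exp_neg_padicValRat v (by exact_mod_cast hq0), hgen, padicValRat.of_nat]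
    have : padicValNat p q = 0 := padicValNat.eq_zero_of_not_dvd hpq
    rw [this]; simp
  have h2 : v.valuation ℚ (2 : ℚ) = 1 := by
    simpa using hnat 2 two_ne_zero (fun h ↦ by have := Nat.le_of_dvd two_pos h; omega)
  have h3 : v.valuation ℚ (3 : ℚ) = 1 := by
    simpa using hnat 3 three_ne_zero (fun h ↦ by have := Nat.le_of_dvd three_pos h; omega)
  have hj0 : W.j ≠ 0 := by rintro h; rw [h, padicValRat.zero] at hj; exact lt_irrefl _ hj
  have hj1 : 1 ≤ v.valuation ℚ W.j := by
    rw [valuation_eq_exp_neg_padicValRat v hj0, hgen, ← exp_zero, exp_le_exp]; linarith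
  obtain ⟨k, hk⟩ := h4
  refine W.isSemistableAt_of_one_le_valuation_j_of_exists_pow_four v h2 h3 hj1 ⟨(p : ℚ) ^ k, ?_⟩
  rw [map_zpow₀, ← hgen, valuation_natGenerator_int, valuation_eq_exp_neg_padicValRat v hc40, hgen,
    ← exp_zsmul, ← exp_nsmul, hk]
  congr 1
  simp only [smul_eq_mul, nsmul_eq_mul]; push_cast; ring

/-- **Upstairs: `ord_p j < 0` and `4 ∣ e(w ∣ p) · ord_p c₄` give semistable reduction of `W_F` at `w`**
(`p ≥ 5`, `F` any number field, `w ∋ p`; `δ` a uniformiser power). [cite: SilvermanAEC2009, VII.5 Prop. 5.1 (b) and Prop. 5.4] -/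
theorem isSemistableAt_baseChange_of_padicValRat_j_neg_of_four_dvd
    (hv : ((primesEquiv (R := ℤ) v : Nat.Primes) : ℕ) = p) (hp5 : 5 ≤ p) (hj : padicValRat p W.j < 0)
    {F : Type*} [Field F] [NumberField F] (w : HeightOneSpectrum (𝓞 F)) (hw : (p : 𝓞 F) ∈ w.asIdeal)
    (h4 : (4 : ℤ) ∣ (v.asIdeal.ramificationIdx' w.asIdeal : ℤ) * padicValRat p W.c₄) :
    (W.baseChange F).IsSemistableAt w := by
  haveI : w.asIdeal.LiesOver v.asIdeal := liesOver_of_natCast_mem_serre v hv w hw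
  have hgen : natGenerator v = p := hv
  have hp : p.Prime := hgen ▸ prime_natGenerator v
  haveI : Fact p.Prime := ⟨hp⟩
  obtain ⟨h2, h3⟩ := two_three_notMem_of_five_le v hv hp5 w hw
  obtain ⟨hc40, -, -⟩ := W.c₄_ne_zero_and_even_padicValRat_c₄_of_padicValRat_j_neg hp hp5 hj
  haveI : (W.baseChange F).IsElliptic := by rw [baseChange]; infer_instance
  have h2u : w.valuation F (2 : F) = 1 := by
    simpa using valuation_natCast_eq_one_of_natCast_notMem (K := F) (q := 2) (by simpa using h2)
  have h3u : w.valuation F (3 : F) = 1 := by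
    simpa using valuation_natCast_eq_one_of_natCast_notMem (K := F) (q := 3) (by simpa using h3)
  have hjF : (W.baseChange F).j = algebraMap ℚ F W.j := W.map_j (algebraMap ℚ F)
  have hc₄F : (W.baseChange F).c₄ = algebraMap ℚ F W.c₄ := by rw [baseChange, map_c₄]
  have hj0 : W.j ≠ 0 := by rintro h; rw [h, padicValRat.zero] at hj; exact lt_irrefl _ hj
  have hjw : 1 ≤ w.valuation F (W.baseChange F).j := by
    rw [hjF, ← valuation_liesOver (K := ℚ) (L := F) v w W.j]
    apply one_le_pow₀
    rw [valuation_eq_exp_neg_padicValRat v hj0, hgen, ← exp_zero, exp_le_exp]; linarith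
  obtain ⟨k, hk⟩ := h4
  obtain ⟨π, hπ⟩ := w.valuation_exists_uniformizer F
  refine (W.baseChange F).isSemistableAt_of_one_le_valuation_j_of_exists_pow_four w h2u h3u hjw ⟨π ^ k, ?_⟩
  rw [hc₄F, ← valuation_liesOver (K := ℚ) (L := F) v w W.c₄, valuation_eq_exp_neg_padicValRat v hc40, hgen,
    map_zpow₀, hπ, ← exp_zsmul, ← exp_nsmul, ← exp_nsmul]
  congr 1
  simp only [smul_eq_mul, nsmul_eq_mul]; push_cast; linarith

omit [W.IsElliptic] in
/-- **Multiplicative reduction upstairs forces `4 ∣ e(w ∣ p) · ord_p c₄(W)`** (any equation `W`, any number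
field `F`, any place `w ∋ p`): the chosen `w`-minimal model is `E • W_{F_w}` with `|c₄|_w = 1`, and
`c₄(E • W) = u⁻⁴ c₄(W)` (Silverman *AEC* III §1 Table 3.1, VII.5 Prop. 5.1 (b)). [cite: SilvermanAEC2009, VII.5 Prop. 5.1 (b) and III.1 Table 3.1] -/
theorem four_dvd_ramificationIdx_mul_padicValRat_c₄_of_hasMultiplicativeReductionAt_baseChange
    (hv : ((primesEquiv (R := ℤ) v : Nat.Primes) : ℕ) = p)
    {F : Type*} [Field F] [NumberField F] (w : HeightOneSpectrum (𝓞 F)) (hw : (p : 𝓞 F) ∈ w.asIdeal)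
    (hmult : (W.baseChange F).HasMultiplicativeReductionAt w) :
    (4 : ℤ) ∣ (v.asIdeal.ramificationIdx' w.asIdeal : ℤ) * padicValRat p W.c₄ := by
  haveI : w.asIdeal.LiesOver v.asIdeal := liesOver_of_natCast_mem_serre v hv w hw
  have hgen : natGenerator v = p := hv
  set e : ℕ := v.asIdeal.ramificationIdx' w.asIdeal with he
  set X := W.baseChange F with hX
  have hXc₄ : X.c₄ = algebraMap ℚ F W.c₄ := by rw [hX, baseChange, map_c₄]
  have hc40 : W.c₄ ≠ 0 := by
    intro h0
    exact hmult.c₄_ne_zero (by rw [hXc₄, h0, map_zero])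
  -- the chosen minimal model `E • X_{F_w}` has unit `c₄`
  have h1 := hmult.multiplicativeReduction
  obtain ⟨E, hE⟩ : ∃ E : VariableChange (w.adicCompletion F),
      X.localMinimalModel w = E • X.baseChange (w.adicCompletion F) := ⟨_, rfl⟩
  rw [hE, variableChange_c₄, (isEquiv_valuation_maximalIdeal_valued w).eq_one_iff_eq_one, map_mul,
    map_pow] at h1
  have hcw : ((X.baseChange (w.adicCompletion F)).c₄) = (X.c₄ : w.adicCompletion F) := by
    rw [baseChange, map_c₄]; rfl
  rw [hcw, valuedAdicCompletion_eq_valuation' w X.c₄, hXc₄,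
    ← valuation_liesOver (K := ℚ) (L := F) v w W.c₄, valuation_eq_exp_neg_padicValRat v hc40, hgen,
    ← he, ← exp_nsmul] at h1
  -- `|u⁻¹|_w = exp s`
  have hu0 : Valued.v (↑E.u⁻¹ : w.adicCompletion F) ≠ 0 := (Valuation.ne_zero_iff _).mpr (Units.ne_zero _)
  set s : ℤ := log (Valued.v (↑E.u⁻¹ : w.adicCompletion F)) with hs
  have hus : Valued.v (↑E.u⁻¹ : w.adicCompletion F) = exp s := by rw [hs, exp_log hu0]
  rw [hus, ← exp_nsmul, ← exp_add, ← exp_zero] at h1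
  have h2 := exp_injective h1
  refine ⟨s, ?_⟩
  simp only [nsmul_eq_mul] at h2
  push_cast at h2
  linarith

/-- **THE WITNESS OF INDEX `2` on the potentially multiplicative rows** (`p ≥ 5`, `ord_p j < 0`): over
`F = ℚ[X]/(minpoly √p)` (`θ² = p`, `[F : ℚ] ≤ 2`) every place `w ∋ p` has `2 ∣ e(w ∣ p) ≤ 2`, hence
`e(w ∣ p) = 2`, and `4 ∣ 2 · ord_p c₄` (`ord_p c₄` is even), so `W_F` is semistable at `w` — in print: an
additive potentially multiplicative `E/ℚ_p` is the twist of a Tate curve by a RAMIFIED quadratic character,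
which becomes unramified over any ramified quadratic extension. [cite: SilvermanAEC2009, VII.5 Prop. 5.1 (b), Prop. 5.4 and C.14]
[cite: Kraus1990, §1 (the potentially multiplicative case: défaut 2), as recalled in FreitasKraus2022 §3.3] -/
theorem isSemistabilityWitnessAt_two_of_padicValRat_j_neg
    (hv : ((primesEquiv (R := ℤ) v : Nat.Primes) : ℕ) = p) (hp5 : 5 ≤ p) (hj : padicValRat p W.j < 0) :
    W.IsSemistabilityWitnessAt p 2 := by
  have hgen : natGenerator v = p := hv
  have hp : p.Prime := hgen ▸ prime_natGenerator v
  obtain ⟨-, -, h2a⟩ := W.c₄_ne_zero_and_even_padicValRat_c₄_of_padicValRat_j_neg hp hp5 hj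
  obtain ⟨F, _, _, θ, hθ, hF⟩ := exists_numberField_pow_eq_algebraMap (p : ℚ) (n := 2) two_pos
  rw [map_natCast] at hθ
  obtain ⟨w, hw, hlies⟩ := exists_place_natCast_mem_liesOver v hv F
  haveI := hlies
  haveI := w.isPrime
  haveI := v.isMaximal
  have hdvd : 2 ∣ v.asIdeal.ramificationIdx' w.asIdeal := dvd_ramificationIdx_of_pow_eq_natCast v hv two_pos hθ w hw
  have hle : v.asIdeal.ramificationIdx' w.asIdeal ≤ 2 :=
    (Ideal.ramificationIdx_le_finrank (𝓞 F) ℚ F w.asIdeal).trans hF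
  have hpos : 0 < v.asIdeal.ramificationIdx' w.asIdeal :=
    Nat.pos_of_ne_zero (Ideal.IsDedekindDomain.ramificationIdx'_ne_zero_of_liesOver w.asIdeal v.ne_bot)
  have he : v.asIdeal.ramificationIdx' w.asIdeal = 2 := le_antisymm hle (Nat.le_of_dvd hpos hdvd)
  have hss := W.isSemistableAt_baseChange_of_padicValRat_j_neg_of_four_dvd v hv hp5 hj w hw
    (by rw [he]; obtain ⟨m, hm⟩ := h2a; exact ⟨m, by rw [hm]; push_cast; ring⟩)
  refine ⟨F, inferInstance, inferInstance, w, hw, ?_, hss⟩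
  rw [← Ideal.ramificationIdx'_eq_ramificationIdx v.asIdeal w.asIdeal v.ne_bot]
  exact he

/-- **Every semistability witness at an ADDITIVE potentially multiplicative `p ≥ 5` has EVEN index**:
semistable upstairs means multiplicative (good is excluded by `|j|_w > 1`), so `4 ∣ e · ord_p c₄`; and
`ord_p c₄ ≡ 2 (mod 4)` because `4 ∣ ord_p c₄` would make `W` semistable at `p` already
(`isSemistableAt_of_padicValRat_j_neg_of_four_dvd`). [cite: SilvermanAEC2009, VII.5 Prop. 5.1 (b),(c) and Prop. 5.4] -/
theorem two_dvd_of_isSemistabilityWitnessAt_of_padicValRat_j_neg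
    (hv : ((primesEquiv (R := ℤ) v : Nat.Primes) : ℕ) = p) (hp5 : 5 ≤ p) (hj : padicValRat p W.j < 0)
    (hns : ¬ W.IsSemistableAt v) {e : ℕ} (hwit : W.IsSemistabilityWitnessAt p e) : 2 ∣ e := by
  have hgen : natGenerator v = p := hv
  have hp : p.Prime := hgen ▸ prime_natGenerator v
  obtain ⟨hc40, -, h2a⟩ := W.c₄_ne_zero_and_even_padicValRat_c₄_of_padicValRat_j_neg hp hp5 hj
  obtain ⟨F, _, _, w, hw, hew, hss⟩ := hwit
  haveI : w.asIdeal.LiesOver v.asIdeal := liesOver_of_natCast_mem_serre v hv w hw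
  haveI := w.isPrime
  have he' : v.asIdeal.ramificationIdx' w.asIdeal = e := by
    rw [Ideal.ramificationIdx'_eq_ramificationIdx v.asIdeal w.asIdeal v.ne_bot, hew]
  rcases hss with hgood | hmult
  · -- good reduction upstairs contradicts `ord_p j < 0`
    have hjv := W.valuation_j_le_one_of_hasGoodReductionAt_baseChange_dedekind F (v := v) (w := w) hgood
    have hj0 : W.j ≠ 0 := by rintro h; rw [h, padicValRat.zero] at hj; exact lt_irrefl _ hj
    rw [valuation_eq_exp_neg_padicValRat v hj0, hgen, ← exp_zero, exp_le_exp] at hjv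
    exact absurd hjv (by linarith)
  · have h4 := W.four_dvd_ramificationIdx_mul_padicValRat_c₄_of_hasMultiplicativeReductionAt_baseChange
      v hv w hw hmult
    rw [he'] at h4
    -- `¬ 4 ∣ ord_p c₄`
    have hn4 : ¬ (4 : ℤ) ∣ padicValRat p W.c₄ := fun h4' ↦
      hns (W.isSemistableAt_of_padicValRat_j_neg_of_four_dvd v hv hp5 hj h4')
    obtain ⟨m, hm⟩ := h2a
    rw [hm] at h4 hn4
    have hmodd : ¬ (2 : ℤ) ∣ m := fun ⟨t, ht⟩ ↦ hn4 ⟨t, by rw [ht]; ring⟩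
    -- `4 ∣ e · 2m` with `m` odd ⇒ `2 ∣ e`
    have h2e : (2 : ℤ) ∣ (e : ℤ) * m := by
      obtain ⟨t, ht⟩ := h4
      exact ⟨t, by linarith⟩
    have := (Int.prime_two.dvd_mul.mp h2e).resolve_right hmodd
    exact_mod_cast this

/-- **KRAUS AT `p ≥ 5`, POTENTIALLY MULTIPLICATIVE ROWS: the semistability defect is EXACTLY `2`** for
`W/ℚ` elliptic, `p ≥ 5`, `ord_p j < 0` and `W` NOT semistable at `p` (additive, Kodaira `Iₙ*`, `n ≥ 1`):
`≤ 2` by the witness `ℚ(√p)`, and no witness of index `1` (every witness index is even). In print: "the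
défaut de semi-stabilité is `2` in the potentially multiplicative case" (Kraus 1990 §1; a ramified
quadratic twist of a Tate curve). [cite: Kraus1990, §1 (potentially multiplicative case), as recalled in FreitasKraus2022 §3.3]
[cite: SilvermanAEC2009, VII.5 Prop. 5.1, Prop. 5.4 and C.14] -/
theorem semistabilityDefectAt_eq_two_of_padicValRat_j_neg_of_not_isSemistableAt
    (hv : ((primesEquiv (R := ℤ) v : Nat.Primes) : ℕ) = p) (hp5 : 5 ≤ p) (hj : padicValRat p W.j < 0)
    (hns : ¬ W.IsSemistableAt v) : W.semistabilityDefectAt p = 2 := by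
  have hwit := W.isSemistabilityWitnessAt_two_of_padicValRat_j_neg v hv hp5 hj
  have hle := semistabilityDefectAt_le hwit
  have hpos : 0 < W.semistabilityDefectAt p := semistabilityDefectAt_pos_of_witness hwit
  have h2 := W.two_dvd_of_isSemistabilityWitnessAt_of_padicValRat_j_neg v hv hp5 hj hns
    (isSemistabilityWitnessAt_semistabilityDefectAt ⟨2, hwit⟩)
  omega

end PotMult

/-! ## §8. The semistable row: defect `1` -/

section Semistable

open Rat.HeightOneSpectrum Literature.NumberTheory.EllipticCurves

variable (W : WeierstrassCurve ℚ) [W.IsElliptic] {p : ℕ} (v : HeightOneSpectrum ℤ)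

/-- **A semistable prime has a witness of index `1`: `F = ℚ`** (`w` the place of `𝓞 ℚ` above `p`,
`e(w ∣ p) ≤ [ℚ : ℚ] = 1`; semistability is stable under base change, `isSemistableAt_baseChange_of_liesOver`,
Silverman *AEC* VII.5 Prop. 5.4 (b)). [cite: SilvermanAEC2009, VII.5 Prop. 5.4 (b)] -/
theorem isSemistabilityWitnessAt_one_of_isSemistableAt
    (hv : ((primesEquiv (R := ℤ) v : Nat.Primes) : ℕ) = p) (hss : W.IsSemistableAt v) :
    W.IsSemistabilityWitnessAt p 1 := by
  obtain ⟨w, hw, hlies⟩ := exists_place_natCast_mem_liesOver v hv ℚ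
  haveI := hlies
  haveI := w.isPrime
  haveI := v.isMaximal
  have hle : v.asIdeal.ramificationIdx' w.asIdeal ≤ 1 :=
    (Ideal.ramificationIdx_le_finrank (𝓞 ℚ) ℚ ℚ w.asIdeal).trans (Module.finrank_self ℚ).le
  have hpos : 0 < v.asIdeal.ramificationIdx' w.asIdeal :=
    Nat.pos_of_ne_zero (Ideal.IsDedekindDomain.ramificationIdx'_ne_zero_of_liesOver w.asIdeal v.ne_bot)
  have he : v.asIdeal.ramificationIdx' w.asIdeal = 1 := le_antisymm hle hpos
  refine ⟨ℚ, inferInstance, inferInstance, w, hw, ?_, W.isSemistableAt_baseChange_of_liesOver ℚ hss⟩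
  rw [← Ideal.ramificationIdx'_eq_ramificationIdx v.asIdeal w.asIdeal v.ne_bot]
  exact he

/-- **THE SEMISTABLE ROW: defect `1`** (`W` semistable at `p` — good or multiplicative — any prime `p`).
[cite: Coppola2020, §2 (L = K^{nr} iff semistable)] [cite: SilvermanAEC2009, VII.5 Prop. 5.4 (b)] -/
theorem semistabilityDefectAt_eq_one_of_isSemistableAt
    (hv : ((primesEquiv (R := ℤ) v : Nat.Primes) : ℕ) = p) (hss : W.IsSemistableAt v) :
    W.semistabilityDefectAt p = 1 := by
  have hwit := W.isSemistabilityWitnessAt_one_of_isSemistableAt v hv hss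
  have hle := semistabilityDefectAt_le hwit
  have hpos : 0 < W.semistabilityDefectAt p := semistabilityDefectAt_pos_of_witness hwit
  omega

/-- **KRAUS'S DÉFAUT DE SEMI-STABILITÉ AT EVERY `p ≥ 5`, COMPLETE**: for `W/ℚ` elliptic and `v` the place
of `ℤ` over the prime `p ≥ 5`, the semistability defect is `1` if `W` is semistable at `p`; `2` if `W` is
additive potentially multiplicative (`ord_p j < 0`); and Serre's `12 / gcd(12, ord_p Δ_min)` if `W` is
(additive) potentially good (`ord_p j ≥ 0`). [cite: Kraus1990, §1 (the case p ≥ 5), as recalled in FreitasKraus2022 §3.3]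
[cite: Serre1972, §5.6 (p. 312)] -/
theorem semistabilityDefectAt_of_five_le
    (hv : ((primesEquiv (R := ℤ) v : Nat.Primes) : ℕ) = p) (hp5 : 5 ≤ p) :
    (W.IsSemistableAt v → W.semistabilityDefectAt p = 1) ∧
      (¬ W.IsSemistableAt v → padicValRat p W.j < 0 → W.semistabilityDefectAt p = 2) ∧
      (0 ≤ padicValRat p W.j →
        W.semistabilityDefectAt p = 12 / Nat.gcd 12 (W.ordMinimalDiscriminant v)) :=
  ⟨fun h ↦ W.semistabilityDefectAt_eq_one_of_isSemistableAt v hv h,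
    fun hns hj ↦ W.semistabilityDefectAt_eq_two_of_padicValRat_j_neg_of_not_isSemistableAt v hv hp5 hj hns,
    fun hj ↦ W.semistabilityDefectAt_eq_twelve_div_gcd_of_five_le v hv hp5 hj⟩

/-- In particular **a semistability witness always exists at `p ≥ 5`** (the semistable reduction theorem,
Silverman *AEC* VII.5 Prop. 5.4 (a), on this class): the defect is never the junk value `0`.
[cite: SilvermanAEC2009, VII.5 Prop. 5.4 (a)] -/
theorem semistabilityDefectAt_pos_of_five_le'
    (hv : ((primesEquiv (R := ℤ) v : Nat.Primes) : ℕ) = p) (hp5 : 5 ≤ p) :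
    0 < W.semistabilityDefectAt p := by
  by_cases hss : W.IsSemistableAt v
  · rw [W.semistabilityDefectAt_eq_one_of_isSemistableAt v hv hss]; exact one_pos
  by_cases hj : 0 ≤ padicValRat p W.j
  · exact W.semistabilityDefectAt_pos_of_five_le v hv hp5 hj
  · rw [W.semistabilityDefectAt_eq_two_of_padicValRat_j_neg_of_not_isSemistableAt v hv hp5 (not_le.mp hj) hss]
    exact two_pos

end Semistable

/-! ## §9. Prime-indexed forms (the currency `HasGoodReductionAtPrime` / `HasMultiplicativeReductionAtPrime`
of `Tamagawa.lean`, in which `Addv W p := ¬ good ∧ ¬ multiplicative` is phrased) and the converse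
"defect `1` ⟹ semistable" at `p ≥ 5` -/

section PrimeIndexed

open Rat.HeightOneSpectrum Literature.NumberTheory.EllipticCurves

variable (W : WeierstrassCurve ℚ) [W.IsElliptic] {p : ℕ} (v : HeightOneSpectrum ℤ)

omit [W.IsElliptic] in
/-- The place `v` of `ℤ` with `primesEquiv v = p` IS `primesEquiv.symm p`. [folklore] -/
private theorem eq_primesEquiv_symm_of_eq (hv : ((primesEquiv (R := ℤ) v : Nat.Primes) : ℕ) = p)
    (hp : p.Prime) : v = (primesEquiv (R := ℤ)).symm ⟨p, hp⟩ := by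
  rw [Equiv.eq_symm_apply]
  exact Subtype.ext hv

/-- **Semistable at the place of `ℤ` over `p` iff good or multiplicative AT THE PRIME `p`** in the
`ℤ_p`-currency of `Tamagawa.lean` (`HasGoodReductionAtPrime`, `HasMultiplicativeReductionAtPrime`, the
predicates negated by the census class `Addv W p`): the tree's transports
`hasGoodReductionAtPrime_iff_hasGoodReductionAt_holds`, `hasMultiplicativeReductionAtPrime_iff_…_holds`
(Silverman *AEC* VII.5 Prop. 5.1 along `ℚ_v ≃ ℚ_[p]`). [cite: SilvermanAEC2009, VII.5 Prop. 5.1 and VII.1 Prop. 1.3 (b)] -/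
theorem isSemistableAt_iff_hasGoodReductionAtPrime_or [Fact p.Prime]
    (hv : ((primesEquiv (R := ℤ) v : Nat.Primes) : ℕ) = p) :
    W.IsSemistableAt v ↔ W.HasGoodReductionAtPrime p ∨ W.HasMultiplicativeReductionAtPrime p := by
  have hp : p.Prime := Fact.out
  have hveq := eq_primesEquiv_symm_of_eq v hv hp
  have hg := W.hasGoodReductionAtPrime_iff_hasGoodReductionAt_holds ⟨p, hp⟩
  have hm := W.hasMultiplicativeReductionAtPrime_iff_hasMultiplicativeReductionAt_holds ⟨p, hp⟩
  rw [← hveq] at hg hm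
  unfold IsSemistableAt
  rw [← hg, ← hm]

/-- **Good or multiplicative at `p` ⟹ defect `1`** (prime-indexed form of
`semistabilityDefectAt_eq_one_of_isSemistableAt`; any prime `p`). [cite: SilvermanAEC2009, VII.5 Prop. 5.4 (b)] -/
theorem semistabilityDefectAt_eq_one_of_good_or_mult [Fact p.Prime]
    (h : W.HasGoodReductionAtPrime p ∨ W.HasMultiplicativeReductionAtPrime p) :
    W.semistabilityDefectAt p = 1 := by
  have hp : p.Prime := Fact.out
  set v : HeightOneSpectrum ℤ := (primesEquiv (R := ℤ)).symm ⟨p, hp⟩ with hvdef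
  have hv : ((primesEquiv (R := ℤ) v : Nat.Primes) : ℕ) = p :=
    congrArg Subtype.val ((primesEquiv (R := ℤ)).apply_symm_apply ⟨p, hp⟩)
  exact W.semistabilityDefectAt_eq_one_of_isSemistableAt v hv
    ((W.isSemistableAt_iff_hasGoodReductionAtPrime_or v hv).mpr h)

/-- **ADDITIVE potentially multiplicative at `p ≥ 5` ⟹ defect `2`**, prime-indexed, with the additivity
hypothesis in the shape `¬ good ∧ ¬ multiplicative` of the census class `Addv W p`
(`Literature/…/Rank1Residual/Predicates.lean`): apply as `… hadd.1 hadd.2 hj`.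
[cite: Kraus1990, §1 (potentially multiplicative case), as recalled in FreitasKraus2022 §3.3] [cite: SilvermanAEC2009, VII.5 Prop. 5.1 and C.14] -/
theorem semistabilityDefectAt_eq_two_of_not_good_of_not_mult [Fact p.Prime] (hp5 : 5 ≤ p)
    (hg : ¬ W.HasGoodReductionAtPrime p) (hm : ¬ W.HasMultiplicativeReductionAtPrime p)
    (hj : padicValRat p W.j < 0) : W.semistabilityDefectAt p = 2 := by
  have hp : p.Prime := Fact.out
  set v : HeightOneSpectrum ℤ := (primesEquiv (R := ℤ)).symm ⟨p, hp⟩ with hvdef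
  have hv : ((primesEquiv (R := ℤ) v : Nat.Primes) : ℕ) = p :=
    congrArg Subtype.val ((primesEquiv (R := ℤ)).apply_symm_apply ⟨p, hp⟩)
  refine W.semistabilityDefectAt_eq_two_of_padicValRat_j_neg_of_not_isSemistableAt v hv hp5 hj ?_
  rw [W.isSemistableAt_iff_hasGoodReductionAtPrime_or v hv]
  rintro (h | h)
  · exact hg h
  · exact hm h

/-- **At `p ≥ 5`, defect `1` forces semistability** (the converse of §8): on the potentially
multiplicative rows the defect of a non-semistable `W` is `2`; on the potentially good rows it is
`12 / gcd(12, ord_p Δ_min)`, and `= 1` means `12 ∣ ord_p Δ_min`, whence GOOD reduction already over `ℚ`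
(`hasGoodReductionAt_baseChange_of_twelve_dvd_ramificationIdx_mul` with `F = ℚ`, transported from the
place of `𝓞 ℚ` to the place of `ℤ` through the `ℤ_p`-currency:
`hasGoodReductionAtPrime_iff_hasGoodReductionAt_ringOfIntegers`, `…_holds`). In print: `Φ_p` trivial iff
`E` semistable at `p` (Serre–Tate). [cite: Serre1972, §5.6 (p. 312)] [cite: SilvermanAEC2009, VII.5 Prop. 5.1 and Prop. 5.4] -/
theorem isSemistableAt_of_semistabilityDefectAt_eq_one
    (hv : ((primesEquiv (R := ℤ) v : Nat.Primes) : ℕ) = p) (hp5 : 5 ≤ p)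
    (h1 : W.semistabilityDefectAt p = 1) : W.IsSemistableAt v := by
  have hgen : natGenerator v = p := hv
  have hp : p.Prime := hgen ▸ prime_natGenerator v
  haveI : Fact p.Prime := ⟨hp⟩
  by_contra hns
  by_cases hj : 0 ≤ padicValRat p W.j
  · -- potentially good: `12 ∣ ord_p Δ_min`, so `W_ℚ` is good at the place of `𝓞 ℚ` over `p`
    rw [W.semistabilityDefectAt_eq_twelve_div_gcd_of_five_le v hv hp5 hj] at h1
    have hg12 : Nat.gcd 12 (W.ordMinimalDiscriminant v) = 12 := by
      have hdvd : Nat.gcd 12 (W.ordMinimalDiscriminant v) ∣ 12 := Nat.gcd_dvd_left _ _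
      have hpos : 0 < Nat.gcd 12 (W.ordMinimalDiscriminant v) := Nat.gcd_pos_of_pos_left _ (by norm_num)
      have := Nat.div_mul_cancel hdvd
      rw [h1, one_mul] at this
      exact this
    have h12 : 12 ∣ W.ordMinimalDiscriminant v := by
      rw [← hg12]; exact Nat.gcd_dvd_right _ _
    obtain ⟨u, hu, hlies⟩ := exists_place_natCast_mem_liesOver v hv ℚ
    haveI := hlies
    have hgoodu : (W.baseChange ℚ).HasGoodReductionAt u :=
      W.hasGoodReductionAt_baseChange_of_twelve_dvd_ramificationIdx_mul v hv hp5 hj u hu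
        (dvd_mul_of_dvd_right h12 _)
    have hbc : W.baseChange ℚ = W := by
      rw [baseChange, show algebraMap ℚ ℚ = RingHom.id ℚ from Subsingleton.elim _ _, map_id]
    rw [hbc] at hgoodu
    -- transport to the `ℤ_p`-currency and back down to the place `v` of `ℤ`
    have hueq : u = (primesEquiv (R := 𝓞 ℚ)).symm ⟨p, hp⟩ :=
      (natCast_mem_asIdeal_iff_eq_primesEquiv_symm u hp).mp hu
    have hpu : primesEquiv (R := 𝓞 ℚ) u = ⟨p, hp⟩ := by rw [hueq, Equiv.apply_symm_apply]
    have hGu := hasGoodReductionAtPrime_iff_hasGoodReductionAt_ringOfIntegers u W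
    have hprime : W.HasGoodReductionAtPrime p := by
      revert hGu
      generalize primesEquiv (R := 𝓞 ℚ) u = q at hpu ⊢
      subst hpu
      exact fun hGu ↦ hGu.mpr hgoodu
    exact hns ((W.isSemistableAt_iff_hasGoodReductionAtPrime_or v hv).mpr (Or.inl hprime))
  · push Not at hj
    have h2 := W.semistabilityDefectAt_eq_two_of_padicValRat_j_neg_of_not_isSemistableAt v hv hp5 hj hns
    omega

/-- **KRAUS–SERRE–TATE AT `p ≥ 5`: the semistability defect is `1` IFF `E` is semistable at `p`.**
[cite: Serre1972, §5.6 (p. 312)] [cite: Coppola2020, §2 (L = K^{nr} iff good reduction over K^{nr})] -/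
theorem semistabilityDefectAt_eq_one_iff_isSemistableAt
    (hv : ((primesEquiv (R := ℤ) v : Nat.Primes) : ℕ) = p) (hp5 : 5 ≤ p) :
    W.semistabilityDefectAt p = 1 ↔ W.IsSemistableAt v :=
  ⟨W.isSemistableAt_of_semistabilityDefectAt_eq_one v hv hp5, W.semistabilityDefectAt_eq_one_of_isSemistableAt v hv⟩

/-- **NOT semistable at `p ≥ 5` ⟹ `1 <` defect** (and then it is `2` or Serre's `12/gcd ∈ {2,3,4,6,12}`).
[cite: Serre1972, §5.6 (p. 312)] -/
theorem one_lt_semistabilityDefectAt_of_not_isSemistableAt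
    (hv : ((primesEquiv (R := ℤ) v : Nat.Primes) : ℕ) = p) (hp5 : 5 ≤ p) (hns : ¬ W.IsSemistableAt v) :
    1 < W.semistabilityDefectAt p := by
  have hpos := W.semistabilityDefectAt_pos_of_five_le' v hv hp5
  have hne : W.semistabilityDefectAt p ≠ 1 := fun h ↦
    hns (W.isSemistableAt_of_semistabilityDefectAt_eq_one v hv hp5 h)
  omega

end PrimeIndexed

/-! ## §10. Serre's table at an ADDITIVE potentially good `p ≥ 5`: `ord_p Δ_min ∈ {2, 3, 4, 6, 8, 9, 10}`,
the defect is `2, 3, 4` or `6` -/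

section AdditiveTable

open Rat.HeightOneSpectrum Literature.NumberTheory.EllipticCurves Literature.NumberTheory.DiophantineGeometry
  IsDiscreteValuationRing

variable (W : WeierstrassCurve ℚ) [W.IsElliptic] {p : ℕ} (v : HeightOneSpectrum ℤ)

omit [W.IsElliptic] in
/-- The residue ring `ℤ ⧸ v` has characteristic `natGenerator v` (private plumbing, as in the sibling
files). [folklore] -/
private theorem ringChar_int_quot_eq_serre : ringChar (ℤ ⧸ v.asIdeal) = natGenerator v := by
  have hmem : (natGenerator v : ℤ) ∈ v.asIdeal := by
    rw [asIdeal_eq_span_natGenerator_int]; exact Ideal.mem_span_singleton_self _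
  haveI : Nontrivial (ℤ ⧸ v.asIdeal) := Ideal.Quotient.nontrivial_iff.mpr v.isPrime.ne_top
  apply CharP.ringChar_of_prime_eq_zero (prime_natGenerator v)
  rw [← map_natCast (Ideal.Quotient.mk v.asIdeal), Ideal.Quotient.eq_zero_iff_mem]
  exact hmem

/-- **At an ADDITIVE potentially good prime `p ≥ 5`, `ord_p Δ_min ∈ {2, 3, 4, 6, 8, 9, 10}`** (Néron /
Tate, Silverman *ATAEC* IV Table 4.1: the additive Kodaira types are II, III, IV, `Iₙ*`, IV*, III*, II*
(`isAdditive_kodairaSymbolAt_iff`), at residue characteristic `≥ 5` one has `ord Δ_min = m + 1`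
(`ordMinimalDiscriminant_eq_numComponentsAt_add_one_holds`), and `Iₙ*` with `n ≥ 1` has `ord_p j < 0`
(`one_lt_valuation_j_of_kodairaSymbolAt_eq_Istar_succ`), excluded by `ord_p j ≥ 0`).
[cite: SilvermanATAEC1994, IV.9 Table 4.1 and IV.9.4 Step 7] -/
theorem ordMinimalDiscriminant_mem_of_hasAdditiveReductionAt_of_padicValRat_j_nonneg
    (hv : ((primesEquiv (R := ℤ) v : Nat.Primes) : ℕ) = p) (hp5 : 5 ≤ p)
    (hadd : W.HasAdditiveReductionAt v) (hj : 0 ≤ padicValRat p W.j) :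
    W.ordMinimalDiscriminant v = 2 ∨ W.ordMinimalDiscriminant v = 3 ∨ W.ordMinimalDiscriminant v = 4 ∨
      W.ordMinimalDiscriminant v = 6 ∨ W.ordMinimalDiscriminant v = 8 ∨ W.ordMinimalDiscriminant v = 9 ∨
      W.ordMinimalDiscriminant v = 10 := by
  haveI : PerfectField (IsLocalRing.ResidueField (v.adicCompletionIntegers ℚ)) := PerfectField.ofFinite
  have hgen : natGenerator v = p := hv
  have h2 : ringChar (ℤ ⧸ v.asIdeal) ≠ 2 := by rw [ringChar_int_quot_eq_serre v, hgen]; omega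
  have h3 : ringChar (ℤ ⧸ v.asIdeal) ≠ 3 := by rw [ringChar_int_quot_eq_serre v, hgen]; omega
  have hord : W.ordMinimalDiscriminant v = W.numComponentsAt v + 1 :=
    W.ordMinimalDiscriminant_eq_numComponentsAt_add_one_holds v hadd h2 h3
  -- `Iₙ*`, `n ≥ 1`, is potentially multiplicative
  have hnotIstar : ∀ n : ℕ, W.kodairaSymbolAt v ≠ .Istar (n + 1) := fun n hT ↦ by
    have h1 := W.one_lt_valuation_j_of_kodairaSymbolAt_eq_Istar_succ v h2 hT
    have hj0 : W.j ≠ 0 := fun h0 ↦ by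
      rw [h0, map_zero] at h1
      exact not_lt.mpr zero_le_one h1
    rw [valuation_eq_exp_neg_padicValRat v hj0, hgen, ← exp_zero, exp_lt_exp] at h1
    omega
  have hK : (W.kodairaSymbolAt v).IsAdditive := (W.isAdditive_kodairaSymbolAt_iff_holds v).mpr hadd
  rw [hord]
  unfold numComponentsAt
  revert hK hnotIstar
  rcases hsym : W.kodairaSymbolAt v with n | _ | _ | _ | n | _ | _ | _ <;> intro hnotIstar hK
  · -- `Iₙ` is not additive
    rcases n with _ | n
    · exact absurd rfl hK.1
    · exact absurd ⟨n + 1, n.succ_ne_zero, rfl⟩ hK.2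
  · decide
  · decide
  · decide
  · rcases n with _ | n
    · decide
    · exact absurd rfl (hnotIstar n)
  · decide
  · decide
  · decide

/-- **At an ADDITIVE potentially good prime `p ≥ 5` the defect is `2, 3, 4` or `6`** (Serre's formula
on the previous table: `12 / gcd(12, a)` for `a = 2, 3, 4, 6, 8, 9, 10` is `6, 4, 3, 2, 3, 4, 6`; Kraus's
`e ∈ {2, 3, 4, 6}` at `p ≥ 5`). Literature-side form of the census theorem
`Summit.BirchSwinnertonDyer.Rank1Residual.Additive.semistabilityIndex_mem_of_addv`.
[cite: Serre1972, §5.6 (p. 312)] [cite: SilvermanATAEC1994, IV.9 Table 4.1] -/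
theorem semistabilityDefectAt_mem_of_hasAdditiveReductionAt_of_padicValRat_j_nonneg
    (hv : ((primesEquiv (R := ℤ) v : Nat.Primes) : ℕ) = p) (hp5 : 5 ≤ p)
    (hadd : W.HasAdditiveReductionAt v) (hj : 0 ≤ padicValRat p W.j) :
    W.semistabilityDefectAt p = 2 ∨ W.semistabilityDefectAt p = 3 ∨ W.semistabilityDefectAt p = 4 ∨
      W.semistabilityDefectAt p = 6 := by
  rw [W.semistabilityDefectAt_eq_twelve_div_gcd_of_five_le v hv hp5 hj]
  rcases W.ordMinimalDiscriminant_mem_of_hasAdditiveReductionAt_of_padicValRat_j_nonneg v hv hp5 hadd hj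
    with h | h | h | h | h | h | h <;> rw [h] <;> decide

omit [W.IsElliptic] in
/-- **Additive, NOT semistable, trichotomy**: `¬ semistable at v ↔ additive at v` for an elliptic `W`
(Silverman *AEC* VII.5 Prop. 5.1: good / multiplicative / additive is a partition). [cite: SilvermanAEC2009, VII.5 Prop. 5.1] -/
theorem not_isSemistableAt_iff_hasAdditiveReductionAt :
    ¬ W.IsSemistableAt v ↔ W.HasAdditiveReductionAt v := by
  constructor
  · intro hns
    rcases hasGoodReductionAt_or_hasMultiplicativeReductionAt_or_hasAdditiveReductionAt v W with h | h | h
    · exact absurd (Or.inl h) hns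
    · exact absurd (Or.inr h) hns
    · exact h
  · rintro hadd (h | h)
    · exact hadd.not_hasGoodReduction _ h
    · exact hadd.not_hasMultiplicativeReduction _ h

/-- **The same table in the `ℤ_p`-currency of `RootNumber.lean`** (`X = (W ⊗ ℚ_p).minimal ℤ_p`
additive, `¬ 3 ord c₄(X) < ord Δ(X)`, `p ≥ 5`): `ord Δ(X) ∈ {2, 3, 4, 6, 8, 9, 10}` — the list in the
docstring of `localRootNumber` ("for the minimal model of an elliptic curve with additive potentially good
reduction and `ℓ ≥ 5` one has `v(Δ) ∈ {2, 3, 4, 6, 8, 9, 10}`"), now a theorem. Transport: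
`hasAdditiveReduction_padic_iff_hasAdditiveReductionAt_int`, §5. [cite: SilvermanATAEC1994, IV.9 Table 4.1]
[cite: Rohrlich1993Compositio, Prop. 2 (iv)] -/
theorem toNat_addVal_Δ_minimal_padic_mem_of_hasAdditiveReduction [Fact p.Prime] (hp5 : 5 ≤ p)
    (hadd : ((W.baseChange ℚ_[p]).minimal ℤ_[p]).HasAdditiveReduction ℤ_[p])
    (hj : ¬ 3 * addVal ℤ_[p] (((W.baseChange ℚ_[p]).minimal ℤ_[p]).integralModel ℤ_[p]).c₄ <
      addVal ℤ_[p] (((W.baseChange ℚ_[p]).minimal ℤ_[p]).integralModel ℤ_[p]).Δ) :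
    (addVal ℤ_[p] (((W.baseChange ℚ_[p]).minimal ℤ_[p]).integralModel ℤ_[p]).Δ).toNat = 2 ∨
      (addVal ℤ_[p] (((W.baseChange ℚ_[p]).minimal ℤ_[p]).integralModel ℤ_[p]).Δ).toNat = 3 ∨
      (addVal ℤ_[p] (((W.baseChange ℚ_[p]).minimal ℤ_[p]).integralModel ℤ_[p]).Δ).toNat = 4 ∨
      (addVal ℤ_[p] (((W.baseChange ℚ_[p]).minimal ℤ_[p]).integralModel ℤ_[p]).Δ).toNat = 6 ∨
      (addVal ℤ_[p] (((W.baseChange ℚ_[p]).minimal ℤ_[p]).integralModel ℤ_[p]).Δ).toNat = 8 ∨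
      (addVal ℤ_[p] (((W.baseChange ℚ_[p]).minimal ℤ_[p]).integralModel ℤ_[p]).Δ).toNat = 9 ∨
      (addVal ℤ_[p] (((W.baseChange ℚ_[p]).minimal ℤ_[p]).integralModel ℤ_[p]).Δ).toNat = 10 := by
  have hp : p.Prime := Fact.out
  set v : HeightOneSpectrum ℤ := (primesEquiv (R := ℤ)).symm ⟨p, hp⟩ with hvdef
  have hv : ((primesEquiv (R := ℤ) v : Nat.Primes) : ℕ) = p :=
    congrArg Subtype.val ((primesEquiv (R := ℤ)).apply_symm_apply ⟨p, hp⟩)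
  have haddv : W.HasAdditiveReductionAt v :=
    (W.hasAdditiveReduction_padic_iff_hasAdditiveReductionAt_int ⟨p, hp⟩).mp hadd
  rw [← W.ordMinimalDiscriminant_eq_toNat_addVal_minimal_padic v hv]
  exact W.ordMinimalDiscriminant_mem_of_hasAdditiveReductionAt_of_padicValRat_j_nonneg v hv hp5 haddv
    ((W.padicValRat_j_nonneg_iff_not_addVal_lt).mpr hj)

omit [W.IsElliptic] in
/-- **Additive reduction of the chosen `ℤ_p`-minimal model `X` puts `c₄(X)` and `Δ(X)` in `𝔪`**
(`0 < ord c₄(X)`, `0 < ord Δ(X)`; Mathlib's `HasAdditiveReduction`, Silverman *AEC* VII.5 Prop. 5.1 (c)),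
the hypothesis shape `addVal … c₄ ≠ 0` of the sign-law files. [cite: SilvermanAEC2009, VII.5 Prop. 5.1 (c)] -/
theorem addVal_ne_zero_of_hasAdditiveReduction_minimal_padic [Fact p.Prime]
    (hadd : ((W.baseChange ℚ_[p]).minimal ℤ_[p]).HasAdditiveReduction ℤ_[p]) :
    addVal ℤ_[p] (((W.baseChange ℚ_[p]).minimal ℤ_[p]).integralModel ℤ_[p]).c₄ ≠ 0 ∧
      addVal ℤ_[p] (((W.baseChange ℚ_[p]).minimal ℤ_[p]).integralModel ℤ_[p]).Δ ≠ 0 := by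
  set X := (W.baseChange ℚ_[p]).minimal ℤ_[p] with hX
  have h1 := hadd.additiveReduction
  have h2 := hadd.badReduction
  rw [← integralModel_c₄_eq ℤ_[p] X] at h1
  rw [← integralModel_Δ_eq ℤ_[p] X] at h2
  exact ⟨(addVal_ne_zero_iff_valuation_lt_one (K := ℚ_[p]) _).mpr h1,
    (addVal_ne_zero_iff_valuation_lt_one (K := ℚ_[p]) _).mpr h2⟩

/-- **Prime-indexed: `¬ good ∧ ¬ multiplicative` at `p` (the census class `Addv W p`) ⟹ the chosen
`ℤ_p`-minimal model is ADDITIVE** (transport `hasAdditiveReduction_padic_iff_hasAdditiveReductionAt_int`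
and the trichotomy). [cite: SilvermanAEC2009, VII.5 Prop. 5.1] -/
theorem hasAdditiveReduction_minimal_padic_of_not_good_of_not_mult [Fact p.Prime]
    (hg : ¬ W.HasGoodReductionAtPrime p) (hm : ¬ W.HasMultiplicativeReductionAtPrime p) :
    ((W.baseChange ℚ_[p]).minimal ℤ_[p]).HasAdditiveReduction ℤ_[p] := by
  have hp : p.Prime := Fact.out
  set v : HeightOneSpectrum ℤ := (primesEquiv (R := ℤ)).symm ⟨p, hp⟩ with hvdef
  have hv : ((primesEquiv (R := ℤ) v : Nat.Primes) : ℕ) = p :=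
    congrArg Subtype.val ((primesEquiv (R := ℤ)).apply_symm_apply ⟨p, hp⟩)
  have hns : ¬ W.IsSemistableAt v := by
    rw [W.isSemistableAt_iff_hasGoodReductionAtPrime_or v hv]
    rintro (h | h)
    · exact hg h
    · exact hm h
  exact (W.hasAdditiveReduction_padic_iff_hasAdditiveReductionAt_int ⟨p, hp⟩).mpr
    ((W.not_isSemistableAt_iff_hasAdditiveReductionAt v).mp hns)

/-- **Prime-indexed: `¬ good ∧ ¬ mult` at `p ≥ 5` and `¬ defect ∣ p − 1` ⟹ POTENTIALLY GOOD** (on the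
potentially multiplicative rows the defect is `2 ∣ p − 1`): the sketch-shaped binder
`¬ W.semistabilityDefectAt p ∣ p − 1` EXCLUDES the potentially multiplicative rows by itself.
[cite: Kraus1990, §1 (potentially multiplicative case: défaut 2), as recalled in FreitasKraus2022 §3.3] -/
theorem padicValRat_j_nonneg_of_not_semistabilityDefectAt_dvd [Fact p.Prime] (hp5 : 5 ≤ p)
    (hg : ¬ W.HasGoodReductionAtPrime p) (hm : ¬ W.HasMultiplicativeReductionAtPrime p)
    (hsc : ¬ W.semistabilityDefectAt p ∣ p - 1) : 0 ≤ padicValRat p W.j := by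
  have hp : p.Prime := Fact.out
  by_contra hj
  push Not at hj
  apply hsc
  rw [W.semistabilityDefectAt_eq_two_of_not_good_of_not_mult hp5 hg hm hj]
  rcases hp.eq_two_or_odd with h | h <;> omega

end AdditiveTable

/-! ## §11. Rohrlich's local root number at an additive `p ≥ 5` READ THROUGH KRAUS'S DEFECT
(Rohrlich 1993 Prop. 2 (iii)/(iv): `W_p = (−1/p)` if `e ∈ {2, 6}` or potentially multiplicative,
`(−3/p)` if `e = 3`, `(−2/p)` if `e = 4`, with `e = |Φ_p| = W.semistabilityDefectAt p`) -/

section LocalRootNumber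

open Rat.HeightOneSpectrum Literature.NumberTheory.EllipticCurves IsDiscreteValuationRing

variable (W : WeierstrassCurve ℚ) [W.IsElliptic] {p : ℕ} [Fact p.Prime]

/-- **ROHRLICH'S FORMULA WITH THE SEMISTABILITY DEFECT** (Compositio 87 (1993) Prop. 2 (iii)–(iv), `p ≥ 5`,
additive reduction): the local root number of `E/ℚ_p` — the tree's `localRootNumber` case list on the chosen
`ℤ_p`-minimal model — is `(−3/p)` if `W.semistabilityDefectAt p = 3`, `(−2/p) = χ₈'(p)` if `= 4`, and
`(−1/p) = χ₄(p)` otherwise, i.e. for defect `2` (type `I₀*` AND every additive potentially multiplicative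
row, where the defect is `2` by §7) or `6`. In print `e` is introduced as `12/gcd(v(Δ),12)` "the order of the
image of inertia"; §5/§7/§10 identify it with Kraus's defect, so the case split may be made on the defect.
[cite: Rohrlich1993Compositio, Prop. 2 (iii)–(iv)] [cite: Serre1972, §5.6 (p. 312)] -/
theorem localRootNumber_padic_eq_of_hasAdditiveReduction_of_five_le (hp5 : 5 ≤ p)
    (hadd : ((W.baseChange ℚ_[p]).minimal ℤ_[p]).HasAdditiveReduction ℤ_[p]) :
    (W.baseChange ℚ_[p]).localRootNumber ℤ_[p] =
      if W.semistabilityDefectAt p = 3 then (if p % 3 = 1 then 1 else -1)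
      else if W.semistabilityDefectAt p = 4 then ZMod.χ₈' p else ZMod.χ₄ p := by
  have hp : p.Prime := Fact.out
  have hg : ¬ W.HasGoodReductionAtPrime p := fun h ↦ hadd.not_hasGoodReduction _ h
  have hm : ¬ W.HasMultiplicativeReductionAtPrime p := fun h ↦ hadd.not_hasMultiplicativeReduction _ h
  rw [localRootNumber_padic_of_hasAdditiveReduction p (W.baseChange ℚ_[p]) hp5 hadd]
  by_cases hj : 3 * addVal ℤ_[p] (((W.baseChange ℚ_[p]).minimal ℤ_[p]).integralModel ℤ_[p]).c₄ <
      addVal ℤ_[p] (((W.baseChange ℚ_[p]).minimal ℤ_[p]).integralModel ℤ_[p]).Δ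
  · -- potentially multiplicative: defect `2`
    have hjQ : padicValRat p W.j < 0 := by
      by_contra h
      push Not at h
      exact (W.padicValRat_j_nonneg_iff_not_addVal_lt (p := p)).mp h hj
    rw [if_pos hj, W.semistabilityDefectAt_eq_two_of_not_good_of_not_mult hp5 hg hm hjQ]
    simp
  · -- potentially good: defect `= 12 / gcd(ord Δ(X), 12) ∈ {2, 3, 4, 6}`
    have hjQ : 0 ≤ padicValRat p W.j := (W.padicValRat_j_nonneg_iff_not_addVal_lt (p := p)).mpr hj
    set v : HeightOneSpectrum ℤ := (primesEquiv (R := ℤ)).symm ⟨p, hp⟩ with hvdef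
    have hv : ((primesEquiv (R := ℤ) v : Nat.Primes) : ℕ) = p :=
      congrArg Subtype.val ((primesEquiv (R := ℤ)).apply_symm_apply ⟨p, hp⟩)
    have haddv : W.HasAdditiveReductionAt v :=
      (W.hasAdditiveReduction_padic_iff_hasAdditiveReductionAt_int ⟨p, hp⟩).mp hadd
    have hmem := W.semistabilityDefectAt_mem_of_hasAdditiveReductionAt_of_padicValRat_j_nonneg v hv hp5 haddv hjQ
    rw [if_neg hj, ← W.semistabilityDefectAt_eq_twelve_div_gcd_addVal_of_five_le hp5 hj]
    rcases hmem with h | h | h | h <;> rw [h] <;> simp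

/-- **`W_p(E) = χ₄(p) = (−1/p)` when the defect is `2` or `6`** (`p ≥ 5`, additive): Rohrlich's rows
`e ∈ {2, 6}` and (iii) (potentially multiplicative, defect `2`). [cite: Rohrlich1993Compositio, Prop. 2 (iii)–(iv)] -/
theorem localRootNumber_padic_eq_χ₄_of_semistabilityDefectAt_eq_two_or_six (hp5 : 5 ≤ p)
    (hadd : ((W.baseChange ℚ_[p]).minimal ℤ_[p]).HasAdditiveReduction ℤ_[p])
    (he : W.semistabilityDefectAt p = 2 ∨ W.semistabilityDefectAt p = 6) :
    (W.baseChange ℚ_[p]).localRootNumber ℤ_[p] = ZMod.χ₄ p := by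
  rw [W.localRootNumber_padic_eq_of_hasAdditiveReduction_of_five_le hp5 hadd]
  rcases he with h | h <;> rw [h] <;> simp

/-- **`W_p(E) = (−3/p)` when the defect is `3`** (`p ≥ 5`, additive; types IV, IV*).
[cite: Rohrlich1993Compositio, Prop. 2 (iv)] -/
theorem localRootNumber_padic_eq_of_semistabilityDefectAt_eq_three (hp5 : 5 ≤ p)
    (hadd : ((W.baseChange ℚ_[p]).minimal ℤ_[p]).HasAdditiveReduction ℤ_[p])
    (he : W.semistabilityDefectAt p = 3) :
    (W.baseChange ℚ_[p]).localRootNumber ℤ_[p] = if p % 3 = 1 then 1 else -1 := by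
  rw [W.localRootNumber_padic_eq_of_hasAdditiveReduction_of_five_le hp5 hadd, he]
  simp

/-- **`W_p(E) = χ₈'(p) = (−2/p)` when the defect is `4`** (`p ≥ 5`, additive; types III, III*).
[cite: Rohrlich1993Compositio, Prop. 2 (iv)] -/
theorem localRootNumber_padic_eq_χ₈'_of_semistabilityDefectAt_eq_four (hp5 : 5 ≤ p)
    (hadd : ((W.baseChange ℚ_[p]).minimal ℤ_[p]).HasAdditiveReduction ℤ_[p])
    (he : W.semistabilityDefectAt p = 4) :
    (W.baseChange ℚ_[p]).localRootNumber ℤ_[p] = ZMod.χ₈' p := by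
  rw [W.localRootNumber_padic_eq_of_hasAdditiveReduction_of_five_le hp5 hadd, he]
  simp

/-- Prime-indexed form with the census-shaped hypothesis `¬ good ∧ ¬ mult` (`Addv W p`):
**`W_p(E)` as a function of `W.semistabilityDefectAt p` at an additive `p ≥ 5`.**
[cite: Rohrlich1993Compositio, Prop. 2 (iii)–(iv)] -/
theorem localRootNumber_padic_eq_of_not_good_of_not_mult (hp5 : 5 ≤ p)
    (hg : ¬ W.HasGoodReductionAtPrime p) (hm : ¬ W.HasMultiplicativeReductionAtPrime p) :
    (W.baseChange ℚ_[p]).localRootNumber ℤ_[p] =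
      if W.semistabilityDefectAt p = 3 then (if p % 3 = 1 then 1 else -1)
      else if W.semistabilityDefectAt p = 4 then ZMod.χ₈' p else ZMod.χ₄ p :=
  W.localRootNumber_padic_eq_of_hasAdditiveReduction_of_five_le hp5
    (W.hasAdditiveReduction_minimal_padic_of_not_good_of_not_mult hg hm)

end LocalRootNumber

end WeierstrassCurve

end
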